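import Mathlib
import Literature.MathematicalPhysics.QuantumFieldTheory.Balaban1983to89.B12SmallFieldRegion255

/-!
# `Balaban1983to89.B12Average012Prop1` — [Balaban1987RG1] p. 254 «especially all results of the paper [12] are
# valid for it. The proofs are in most cases unchanged; in others only minor and obvious modifications are needed»:
# [12] = [B7]'s PROPOSITION 1 (51) «|Ū(∂p′) − 1| < L²α₀ + C₀(L²α₀)²» PROVED for the average (0.12) built from the
# AVERAGED CONTOUR VARIABLES (0.11), on the b12 lineage's `ℤᵈ` corner-cube geometry, with explicit constants
# `C₀ = 500·64(d+1)²(d+4)²`, `c₂′ = 1/(512(d+1)(d+4)L²)`; the «minor and obvious modification» made explicit: to second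
# order the (0.12)/(0.11) average is the coarse gauge transform `e^{−Ξ}` of the (0.12) average over the tree contours

HONEST FRAMING (cell `lit-balaban`, verbatim): statement-level skeleton of published theorems with citation tags;
proofs where landed; nothing here is a claim about the Yang–Mills mass gap.

CITATION HEADER.  T. Bałaban, *Renormalization group approach to lattice gauge field theories. I. Generation of
effective actions in a small field approximation and a coupling constant renormalization in four dimensions*,
Commun. Math. Phys. **109** (1987) 249–301, doi:10.1007/bf01215223 [Balaban1987RG1] (cell paper B12 = «[I]»).  PDF
held: `paper:balaban1987-cmp109-rg-i-small-field` (journal page = PDF page + 248); p. 254 [PDF 6] re-read this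
generation from the held text (`lit read … --pages 6`, lines 2–13).  [12] = [B7] = [Balaban1985Averaging] T. Bałaban,
*Averaging operations for lattice gauge theories*, Commun. Math. Phys. **98** (1985) 17–51, Proposition 1 (51) p. 26
— its printed statement is quoted from the tree leaf `B7.Prop1Printed` (module `B7`, which READ p. 26), and its tree
PROOF for the average (42) is `B7Prop1Explicit.prop1_explicit` / `prop1Printed_concrete` (b07 lineage); nothing of
[B7] is re-quoted from memory here.  Unit `lit-balaban-r09` gen 9 (display owner of CMP 109; TAKING line
`HOME/STATUS.md` 2026-08-21T08:2xZ «TAKING + READY: [B7] Proposition 1 (51) … for [I]'s actual (0.12) average»), HOME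
`run/shared/lean/pub/lit-balaban/`; SKELETON rows `B12.Eq0.12` (D + C: the average and the sentence «all results of
the paper [12] are valid for it»), `B7.Prop1` (consumer side: the [B7] row is r04's; this file adds an INSTANCE of
the printed leaf for a different average, it does not touch the [B7] row's head).

WHAT IS PRINTED (verbatim, [I] p. 254 [PDF 6] lines 2–13): *«… as in [12], we introduce the definition
Ū(c) = exp[i Σ_{x∈B(c₋)} L⁻ᵈ (1/i) log 𝐔(c₋, x)𝐔([x, x′])𝐔(x′, c₊)𝐔(−c)] 𝐔(c). (0.12)  This average has
properties similar to the properties of the average introduced in (0.4), especially all results of the paper [12]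
are valid for it. The proofs are in most cases unchanged; in others only minor and obvious modifications are
needed. These modifications are connected again rather with the fact that we consider Gᶜ-valued configurations,
than with the different definition of the average. Let us stress that both definitions are equally good for our
purposes, in fact we may use many other definitions. It is possible to axiomatize them also, listing all essential
properties, but it is not interesting enough to do it here.»*  [B7] Proposition 1, p. 26 (quoted from the tree leaf
`B7.Prop1Printed`): *«There exist positive constants C₀, c′₂ such that for every configuration V satisfying (44) for
p ⊂ Δ(p′) and for α₀ ≤ c′₂, we have |V̄(∂p′) − 1| < L²α₀ + C₀(L²α₀)² (51).  The constant C₀ depends on d and c′₂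
depends on d and L.»*

DICTIONARY print → Lean (objects PRE-EXISTING in the b12/b07 lineages unless marked NEW).  Fine lattice `ℤᵈ`, bonds
`ZdEdge d`; corner cubes `B(y) = L·y + {0,…,L−1}ᵈ` (`blockSites L y`, base point `blockBase L y = L·y` for print's
`y ∈ B(y)`; DIVERGENCE (a)); coarse bonds `c = (y, μ)`, `x′ = x(c) = x + Le_μ`; `G`-valued ↦ `U1 𝔸`-valued
(`‖u‖, ‖u⁻¹‖ ≤ 1`) in a complete normed `ℂ`-algebra with `‖1‖ = 1`; (44) «|V(∂p) − 1| < α₀» ↦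
`‖plaquetteHolonomyZd U p i j − 1‖ ≤ α₀` for all plaquettes of `ℤᵈ` ([I] p. 254 «p ∈ T»; a superset of [B7]'s
«p ⊂ Δ(p′)», as in `B7Prop1Explicit.concreteOneStep`); the averaged contour variable (0.11) `𝐔(q,x)` ↦
`B12ContourAverage253.Tavg L U x = X(x)⁻¹·U(Γ_{q,x})` (Federbush's mean (0.10) via the tree's local solution
`fedSol`; `Tavg_eq`), with NEW names for its pieces: the Federbush factor `fedX L U x = X(x)`, `xi = log X`, the block
mean `Xi L U y = Ξ(y) = Σ_{x∈B(y)} L⁻ᵈ ξ(x)`; the average (0.12) over the (0.11) variables `Ū(c)` ↦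
`B12SmallFieldRegion255.avgBar L U c = B12AverageCorridor267.avgM L (Tavg L) U c`; the average (0.12) over the TREE
contours `Γ_{y,x}` of [2] (1.7) (= [B7] (42) on corner cubes) ↦ NEW abbreviation `avgT L U c = avgM L (gammaT L) U c`,
PROVED equal to `B7Prop1Explicit.bavg L (Function.curry U) (L·c₋) c.2` (`avgT_eq_bavg`); coarse plaquette variables
`Ū(∂p′)` ↦ `plaquetteHolonomyZd (avgBar L U) y μ ν` (= [B7]'s `cplaq` at the base point `L·y`, `plaq_avgT_eq_cplaq`);
the comparison configuration ↦ NEW `avgTw L U = gaugeTransformZd (wXi L U) (avgT L U)`, `wXi L U y = e^{−Ξ(y)}`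
(`QuantumLattice.gaugeTransformZd` on the coarse lattice); [B7]'s abstract one-step carrier / printed leaf ↦
`B7.OneStep` / `B7.Prop1Printed` (module `B7`), instantiated by NEW `concreteOneStep012`.

THE ARGUMENT FORMALISED (print gives none beyond «minor and obvious modifications»; every input a tree theorem BY
NAME).  Fix a coarse bond `c = (y, μ)`, `S = U(c) = U([Ly, Ly + Le_μ])` (`Ustr`), and write `δ = (dL)²α₀`.
(i) FACTORISATION (§ 3, `loopW_Tavg_factor` = `B12ContourAverage253.loop_factor`): with `𝐔(c₋,x) = X(x)⁻¹U(Γ_{c₋,x})`,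
`𝐔(c₊,x′) = X(x′)⁻¹U(Γ_{c₊,x′})`, the (0.12) loop of the averaged variables is
`W^avg_x = X(x)⁻¹ · W^tree_x · (S X(x′) S⁻¹)`, the three factors being within `4δ`, `δ`, `3δ` of `1`
(`B12ContourAverage253.norm_fedAvg_mul_inv_sub_one_le` / `FederbushMean.norm_fedSol_sub_one_le` on the `(dL)²α₀`-small
relative family `norm_permT_mul_gammaT_inv_sub_one_le`; `B12PlaquetteLoop267.norm_loopW_sub_one_le_local` +
`omegaC_le`).  (ii) LOGARITHMS TO SECOND ORDER (§ 0, § 3): for the series logarithm, `‖log(PZQ) − (log P + log Z +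
log Q)‖ ≤ 16(p+z+q)²` (`B7Prop1Explicit.norm_mlog_sub_le` = [B7] (26)–(27)), `log X⁻¹ = −log X`
(`ExpMeanLog.mlog_eq_neg_of_mul_eq_one`), `log(SXS⁻¹) = S(log X)S⁻¹` (`B7Prop1Explicit.mlog_units_conj` = [B7] (23));
hence `log W^avg_x = −ξ(x) + log W^tree_x + S ξ(x′) S⁻¹ + E_x`, `‖E_x‖ ≤ 1024δ²` (`norm_mlog_loopW_Tavg_sub_le`).
(iii) BLOCK MEANS (§ 4): averaging over `x ∈ B(y)` and re-indexing `x ↦ x′` between `B(y)` and `B(y + e_μ)`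
(`B7BlockGeometry.blockSites_add_single`): the exponent of (0.12) is `A_avg(c) = −Ξ(y) + A_tree(c) + SΞ(y+e_μ)S⁻¹ +
E(c)`, `‖E(c)‖ ≤ 1024δ²` (`expo_Tavg_eq`, `norm_Erem_le`).  (iv) EXPONENTIALS TO SECOND ORDER (§ 0, § 5):
`‖e^{a+b+c+e} − e^a e^b e^c‖ ≤ (α+β+γ+η)² + 3(α+β+γ)² + η` (`B7Prop1Explicit.norm_exp_sub_one_le_of_norm_le`,
`expRem_le_sq`) with `‖Ξ‖ ≤ 6δ`, `‖A_tree‖ ≤ 2δ`, and `e^{SΞ′S⁻¹}S = SΞ′`-conjugation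
(`B12AverageCorridor267.exp_conj_units`): **`‖Ū(c) − e^{−Ξ(c₋)}·M^tree(c)·e^{Ξ(c₊)}‖ ≤ 2200δ²`**
(`norm_avgBar_sub_avgTw_le`), i.e. `Ū` is the coarse gauge transform `(M^tree)^w`, `w = e^{−Ξ}`, up to `O(δ²)`.
(v) PLAQUETTES (§ 5–§ 6): the four factors of `Ū(∂p′)` and of `(M^tree)^w(∂p′)` have norms `≤ e^{20δ}`, so
`‖Ū(∂p′) − (M^tree)^w(∂p′)‖ ≤ 4e^{100δ}·2200δ² ≤ 11000δ²` (`norm_plaq_avgBar_sub_plaq_avgTw_le`, `δ ≤ 1/512`), while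
`(M^tree)^w(∂p′) = w(y)·M^tree(∂p′)·w(y)⁻¹` (`QuantumLattice.plaquetteHolonomyZd_gaugeTransformZd`) and
`‖M^tree(∂p′) − 1‖ ≤ L²α₀ + 226θ²`, `θ = 8(d+1)(d+4)L²α₀`, is [B7] Proposition 1 for the tree average
(`prop1_avgT` = `B7Prop1Explicit.prop1_explicit` along `plaq_avgT_eq_cplaq`); with `δ ≤ θ/8`, `θ ≤ 1/64`:
**`‖Ū(∂p′) − 1‖ ≤ L²α₀ + 500θ²`** (`prop1_avgBar`), and the printed leaf with the strict `<` and the quantifier order of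
p. 26 (`prop1Printed_avgBar`, via an intermediate `α₁`, exactly as `B7Prop1Explicit.prop1Printed_concrete`).

WHAT IS PROVED (kernel-checked, no `sorry`, axioms `propext`, `Classical.choice`, `Quot.sound`; definitions with
bodies: `avgT`, `fedX`, `xi`, `Xi`, `expo`, `Erem`, `wXi`, `avgTw`, `concreteOneStep012` — abbreviations of lineage
objects and the bookkeeping of the comparison; everything else theorems; NO `Prop` placeholder, net new unproved
facts 0).  Main: `prop1_avgBar`, `prop1Printed_avgBar`; structural: `avgT_eq_bavg`, `plaq_avgT_eq_cplaq`, `prop1_avgT`,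
`loopW_Tavg_factor`, `norm_mlog_loopW_Tavg_sub_le`, `expo_Tavg_eq`, `norm_Erem_le`, `val_avgTw`,
`norm_avgBar_sub_avgTw_le`, `norm_plaq_avgBar_sub_plaq_avgTw_le`; bounds `norm_fedX_sub_one_le`, `norm_xi_le`,
`norm_Xi_le`, `norm_expo_gammaT_le`, `norm_expo_Tavg_le`, `norm_avgBar_le`, `norm_avgTw_le`.

DIVERGENCES FROM PRINT / WHAT IS NOT PROVED (honest scope).  (a) GEOMETRY AND VALUES: `ℤᵈ` with corner cubes and the
lineage's realisation of (0.10)–(0.12) (`B12ContourAverage253` DIVERGENCE D-b12g23.1 (a)–(f) inherited verbatim: all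
`d!` axis orderings as `𝐆(q,x)`, Federbush's mean via the tree's local solution `fedSol`, `𝐔(x′,c₊) = 𝐔(c₊,x′)⁻¹`);
`U1 𝔸`-valued configurations (contain `G = U(N) ⊂ M_N(ℂ)`), NOT print's `Gᶜ`-valued ones — p. 254's remark that the
modifications «are connected … rather with the fact that we consider Gᶜ-valued configurations» is therefore NOT
exercised here; weak inequalities and regularity on all of `ℤᵈ` for [B7]'s strict (44) on `Δ(p′)`.  (b) ONLY
PROPOSITION 1 of [12] is transported (the first of «all results of the paper [12]»); Propositions 2–10, the analyticity
statements and the `k`-fold iteration (52)–(54) for the (0.11)/(0.12) average are NOT touched (the lineage has the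
`h`-paragraph `B12ContourAverage253.h_paragraph_p267_average` and the gauge covariance `B12Average012Covariance`).
(c) CONSTANTS: `C₀ = 500·64(d+1)²(d+4)²`, `c₂′ = 1/(512(d+1)(d+4)L²)` are this file's (print: «C₀ depends on d and
c′₂ depends on d and L» — the dependence proved is exactly that); the route's intermediate constants 1024, 2200,
11000 are crude.  (d) The identification `Ū ≈ (M^tree)^{e^{−Ξ}}` is this file's reading of «minor and obvious
modifications», not a printed formula.

DOCFIX (unit `lit-balaban-r09` gen 13): the [Balaban1984PropagatorsI] locator of `sum_blockSites_succ` «(1.8) p.18» → «(1.8) p.19» (CMP 95 p. 19 carries (1.8) with «x(c) = x + Le_μ»; CITELOC row P31-095 of `pub-balaban` summit-lit1, read on the page image `b2b-balaban-ref1/pages/1984-cmp95-propagators-rt-I/…-p003-x2.png` by this seat); no declaration, statement or proof changed.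
-/

noncomputable section

open NormedSpace Finset

namespace Literature.MathematicalPhysics.QuantumFieldTheory.Balaban1983to89.B12Average012Prop1

open Literature.MathematicalPhysics.QuantumLattice (ZdEdge blockMap blockBase blockSites mem_blockSites_iff
  card_blockSites plaquetteHolonomyZd gaugeTransformZd plaquetteHolonomyZd_gaugeTransformZd)
open B7BlockGeometry (blockSites_add_single)
open B7Eq61Linearization (lineR)
open B7Prop1Explicit (e seg hol U1 mem_U1 hol_mem norm_units_conj_sub_one_le boxVec Wcx Xavg bavg cplaq plaqWord
  expUnit val_expUnit expRem expRem_le_sq expRem_mono norm_exp_sub_one_le_of_norm_le norm_mlog_sub_le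
  mlog_units_conj prop1_explicit)
open B8Lemma1NonAbelian (pairTop boxVec_le_pairTop boxVec_add_seg_le_pairTop norm_triple_sub_one_le)
open B12HOperator267 (gammaT axisSite)
open B12AverageCorridor267 (Ustr loopW loopW_def avgM expU val_expU val_inv_expU add_mem_blockSites_succ
  blockBase_add_single exp_conj_units bounds_of_mem_blockSites mem_blockSites_of_bounds)
open B12PlaquetteLoop267 (zsmul_e exists_boxVec hol_seg_eq_lineR loopW_gammaT_eq_Wcx hol_curry_plaqWord
  norm_loopW_sub_one_le_local)
open B12ContourAverage253 (rel permT permT_one permT_axis fedUnit val_fedUnit fedAvg_mul_inv Tavg Tavg_eq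
  norm_permT_mul_gammaT_inv_sub_one_le omegaA omegaC_le loop_factor norm_le_one_add
  norm_loopW_Tavg_sub_one_le_local)
open B12SmallFieldRegion255 (avgBar)
open FederbushMean (fedSol fedSol_const_one norm_fedSol_sub_one_le)
open MatrixLog (mlog mlog_one norm_mlog_le_two_mul)

variable {d : ℕ}

/-! ## § 0  Toolkit: second-order algebra in a normed ring [folklore] -/

section Toolkit

variable {𝔸 : Type*} [NormedRing 𝔸]

/-- [folklore] `ghk − 1 − [(g−1)+(h−1)+(k−1)] = (g−1)(h−1) + (g−1)(k−1) + (h−1)(k−1) + (g−1)(h−1)(k−1)` is of second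
order. -/
private theorem norm_mul3_sub_one_sub_le (g h k : 𝔸) :
    ‖g * h * k - 1 - ((g - 1) + (h - 1) + (k - 1))‖
      ≤ ‖g - 1‖ * ‖h - 1‖ + ‖g - 1‖ * ‖k - 1‖ + ‖h - 1‖ * ‖k - 1‖ + ‖g - 1‖ * ‖h - 1‖ * ‖k - 1‖ := by
  have e3 : g * h * k - 1 - ((g - 1) + (h - 1) + (k - 1))
      = (g - 1) * (h - 1) + (g - 1) * (k - 1) + (h - 1) * (k - 1) + (g - 1) * (h - 1) * (k - 1) := by
    noncomm_ring
  rw [e3]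
  have h3 : ‖(g - 1) * (h - 1) * (k - 1)‖ ≤ ‖g - 1‖ * ‖h - 1‖ * ‖k - 1‖ :=
    (norm_mul_le _ _).trans (mul_le_mul_of_nonneg_right (norm_mul_le _ _) (norm_nonneg _))
  exact (norm_add_le _ _).trans (add_le_add ((norm_add_le _ _).trans (add_le_add ((norm_add_le _ _).trans
    (add_le_add (norm_mul_le _ _) (norm_mul_le _ _))) (norm_mul_le _ _))) h3)

/-- [folklore] `‖xyzw‖ ≤ ‖x‖‖y‖‖z‖‖w‖`. -/
private theorem norm_mul4_le (x y z w : 𝔸) : ‖x * y * z * w‖ ≤ ‖x‖ * ‖y‖ * ‖z‖ * ‖w‖ :=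
  (norm_mul_le _ _).trans (mul_le_mul_of_nonneg_right ((norm_mul_le _ _).trans
    (mul_le_mul_of_nonneg_right (norm_mul_le _ _) (norm_nonneg _))) (norm_nonneg _))

/-- [folklore] monotonicity of a product of four non-negative reals. -/
private theorem prod4_le {a b c d' A B C D : ℝ} (ha : 0 ≤ a) (hb : 0 ≤ b) (hc : 0 ≤ c) (hd : 0 ≤ d')
    (h1 : a ≤ A) (h2 : b ≤ B) (h3 : c ≤ C) (h4 : d' ≤ D) : a * b * c * d' ≤ A * B * C * D := by
  have hA : 0 ≤ A := ha.trans h1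
  have hB : 0 ≤ B := hb.trans h2
  have hC : 0 ≤ C := hc.trans h3
  exact mul_le_mul (mul_le_mul (mul_le_mul h1 h2 hb hA) h3 hc (mul_nonneg hA hB)) h4 hd
    (mul_nonneg (mul_nonneg hA hB) hC)

/-- [folklore] the telescoping estimate for a product of four factors:
`ABCD − A′B′C′D′ = (A−A′)BCD + A′(B−B′)CD + A′B′(C−C′)D + A′B′C′(D−D′)`. -/
private theorem norm_mul4_sub_mul4_le {A B C D A' B' C' D' : 𝔸} {M ηA ηB ηC ηD : ℝ}
    (hB : ‖B‖ ≤ M) (hC : ‖C‖ ≤ M) (hD : ‖D‖ ≤ M) (hA' : ‖A'‖ ≤ M) (hB' : ‖B'‖ ≤ M) (hC' : ‖C'‖ ≤ M)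
    (hdA : ‖A - A'‖ ≤ ηA) (hdB : ‖B - B'‖ ≤ ηB) (hdC : ‖C - C'‖ ≤ ηC) (hdD : ‖D - D'‖ ≤ ηD) :
    ‖A * B * C * D - A' * B' * C' * D'‖ ≤ M ^ 3 * (ηA + ηB + ηC + ηD) := by
  have e4 : A * B * C * D - A' * B' * C' * D'
      = (A - A') * B * C * D + A' * (B - B') * C * D + A' * B' * (C - C') * D + A' * B' * C' * (D - D') := by
    noncomm_ring
  rw [e4]
  have n := fun (x : 𝔸) => norm_nonneg x
  have t1 : ‖(A - A') * B * C * D‖ ≤ ηA * M * M * M :=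
    (norm_mul4_le _ _ _ _).trans (prod4_le (n _) (n _) (n _) (n _) hdA hB hC hD)
  have t2 : ‖A' * (B - B') * C * D‖ ≤ M * ηB * M * M :=
    (norm_mul4_le _ _ _ _).trans (prod4_le (n _) (n _) (n _) (n _) hA' hdB hC hD)
  have t3 : ‖A' * B' * (C - C') * D‖ ≤ M * M * ηC * M :=
    (norm_mul4_le _ _ _ _).trans (prod4_le (n _) (n _) (n _) (n _) hA' hB' hdC hD)
  have t4 : ‖A' * B' * C' * (D - D')‖ ≤ M * M * M * ηD :=
    (norm_mul4_le _ _ _ _).trans (prod4_le (n _) (n _) (n _) (n _) hA' hB' hC' hdD)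
  have hsum : ηA * M * M * M + M * ηB * M * M + M * M * ηC * M + M * M * M * ηD
      = M ^ 3 * (ηA + ηB + ηC + ηD) := by ring
  calc _ ≤ ‖(A - A') * B * C * D‖ + ‖A' * (B - B') * C * D‖ + ‖A' * B' * (C - C') * D‖
          + ‖A' * B' * C' * (D - D')‖ :=
        (norm_add_le _ _).trans (add_le_add ((norm_add_le _ _).trans (add_le_add (norm_add_le _ _) le_rfl)) le_rfl)
    _ ≤ _ := by rw [← hsum]; linarith

/-- [folklore] inverses of nearby units are nearby: `C⁻¹ − C′⁻¹ = C⁻¹(C′ − C)C′⁻¹`. -/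
private theorem norm_inv_sub_inv_le {C C' : 𝔸ˣ} {M η : ℝ} (hC : ‖((C⁻¹ : 𝔸ˣ) : 𝔸)‖ ≤ M)
    (hC' : ‖((C'⁻¹ : 𝔸ˣ) : 𝔸)‖ ≤ M) (h : ‖(C : 𝔸) - C'‖ ≤ η) :
    ‖((C⁻¹ : 𝔸ˣ) : 𝔸) - ((C'⁻¹ : 𝔸ˣ) : 𝔸)‖ ≤ M * η * M := by
  have hM : 0 ≤ M := (norm_nonneg _).trans hC
  have ei : ((C⁻¹ : 𝔸ˣ) : 𝔸) - ((C'⁻¹ : 𝔸ˣ) : 𝔸)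
      = ((C⁻¹ : 𝔸ˣ) : 𝔸) * ((C' : 𝔸) - C) * ((C'⁻¹ : 𝔸ˣ) : 𝔸) := by
    rw [mul_sub, sub_mul, mul_assoc ((C⁻¹ : 𝔸ˣ) : 𝔸) (C' : 𝔸), Units.mul_inv, mul_one, Units.inv_mul,
      one_mul]
  rw [ei]
  calc _ ≤ ‖((C⁻¹ : 𝔸ˣ) : 𝔸) * ((C' : 𝔸) - C)‖ * ‖((C'⁻¹ : 𝔸ˣ) : 𝔸)‖ := norm_mul_le _ _
    _ ≤ (‖((C⁻¹ : 𝔸ˣ) : 𝔸)‖ * ‖(C' : 𝔸) - C‖) * M := by gcongr; exact norm_mul_le _ _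
    _ ≤ (M * η) * M := by
        refine mul_le_mul_of_nonneg_right (mul_le_mul hC ?_ (norm_nonneg _) hM) hM
        rwa [norm_sub_rev]

/-- [folklore] `‖u v u⁻¹‖ ≤ ‖v‖` for a unit with `‖u‖, ‖u⁻¹‖ ≤ 1`. -/
private theorem norm_units_conj_le [NormOneClass 𝔸] {u : 𝔸ˣ} (hu : u ∈ U1 𝔸) (v : 𝔸) :
    ‖(u : 𝔸) * v * ((u⁻¹ : 𝔸ˣ) : 𝔸)‖ ≤ ‖v‖ :=
  calc _ ≤ ‖(u : 𝔸) * v‖ * ‖((u⁻¹ : 𝔸ˣ) : 𝔸)‖ := norm_mul_le _ _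
    _ ≤ (‖(u : 𝔸)‖ * ‖v‖) * 1 := by gcongr; exacts [norm_mul_le _ _, hu.2]
    _ ≤ (1 * ‖v‖) * 1 := by gcongr; exact hu.1
    _ = ‖v‖ := by ring

variable [NormedAlgebra ℂ 𝔸] [CompleteSpace 𝔸]

/-- [folklore] the series logarithm to second order: `‖log W − (W − 1)‖ ≤ 4w²` for `‖W − 1‖ ≤ w ≤ 1/2`
(`B7Prop1Explicit.norm_mlog_sub_le`, `expRem_le_sq`). -/
private theorem norm_mlog_sub_lin_le {W : 𝔸} {w : ℝ} (hW : ‖W - 1‖ ≤ w) (hw : w ≤ 1 / 2) :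
    ‖mlog W - (W - 1)‖ ≤ 4 * w ^ 2 := by
  have hw0 : 0 ≤ w := (norm_nonneg _).trans hW
  have h1 := norm_mlog_sub_le (hW.trans hw)
  have h2 : expRem (2 * ‖W - 1‖) ≤ expRem (2 * w) := expRem_mono (by positivity) (by linarith)
  have h3 : expRem (2 * w) ≤ (2 * w) ^ 2 := expRem_le_sq (by positivity) (by linarith)
  calc _ ≤ expRem (2 * ‖W - 1‖) := h1
    _ ≤ (2 * w) ^ 2 := h2.trans h3
    _ = 4 * w ^ 2 := by ring

/-- [folklore] **the logarithm of a triple product to second order**: for `‖P − 1‖ ≤ p`, `‖Z − 1‖ ≤ z`, `‖Q − 1‖ ≤ q`,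
`p + z + q ≤ 1/10`: `‖log(PZQ) − (log P + log Z + log Q)‖ ≤ 16(p + z + q)²` (series logarithm). -/
private theorem norm_mlog_mul3_sub_le {P Z Q : 𝔸} {p z q : ℝ} (hP : ‖P - 1‖ ≤ p) (hZ : ‖Z - 1‖ ≤ z)
    (hQ : ‖Q - 1‖ ≤ q) (ht : p + z + q ≤ 1 / 10) :
    ‖mlog (P * Z * Q) - (mlog P + mlog Z + mlog Q)‖ ≤ 16 * (p + z + q) ^ 2 := by
  have hp0 : 0 ≤ p := (norm_nonneg _).trans hP
  have hz0 : 0 ≤ z := (norm_nonneg _).trans hZ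
  have hq0 : 0 ≤ q := (norm_nonneg _).trans hQ
  -- the second-order part of `PZQ − 1`
  have hpz : ‖P - 1‖ * ‖Z - 1‖ ≤ p * z := mul_le_mul hP hZ (norm_nonneg _) hp0
  have hpq : ‖P - 1‖ * ‖Q - 1‖ ≤ p * q := mul_le_mul hP hQ (norm_nonneg _) hp0
  have hzq : ‖Z - 1‖ * ‖Q - 1‖ ≤ z * q := mul_le_mul hZ hQ (norm_nonneg _) hz0
  have hpzq : ‖P - 1‖ * ‖Z - 1‖ * ‖Q - 1‖ ≤ p * z * q :=
    mul_le_mul hpz hQ (norm_nonneg _) (mul_nonneg hp0 hz0)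
  set r2 : ℝ := p * z + p * q + z * q + p * z * q with hr2def
  have hr20 : 0 ≤ r2 := by positivity
  have hr2 : ‖P * Z * Q - 1 - ((P - 1) + (Z - 1) + (Q - 1))‖ ≤ r2 :=
    (norm_mul3_sub_one_sub_le P Z Q).trans (by linarith)
  have hr2t : r2 ≤ (p + z + q) ^ 2 := by
    have := mul_nonneg (mul_nonneg hp0 hz0) (by linarith : (0 : ℝ) ≤ 1 / 10 - q)
    nlinarith [mul_nonneg hp0 hz0, mul_nonneg hp0 hq0, mul_nonneg hz0 hq0, sq_nonneg p, sq_nonneg z, sq_nonneg q]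
  -- the size of `PZQ − 1`
  have hlin : ‖(P - 1) + (Z - 1) + (Q - 1)‖ ≤ p + z + q :=
    (norm_add_le _ _).trans (add_le_add ((norm_add_le _ _).trans (add_le_add hP hZ)) hQ)
  have hW : ‖P * Z * Q - 1‖ ≤ (p + z + q) + r2 := by
    calc ‖P * Z * Q - 1‖ = ‖(P * Z * Q - 1 - ((P - 1) + (Z - 1) + (Q - 1))) + ((P - 1) + (Z - 1) + (Q - 1))‖ := by
          rw [sub_add_cancel]
      _ ≤ r2 + (p + z + q) := (norm_add_le _ _).trans (add_le_add hr2 hlin)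
      _ = _ := by ring
  have hs : (p + z + q) + r2 ≤ 11 / 10 * (p + z + q) := by nlinarith
  have hlogW := norm_mlog_sub_lin_le hW (by linarith)
  have hlogP := norm_mlog_sub_lin_le hP (by linarith)
  have hlogZ := norm_mlog_sub_lin_le hZ (by linarith)
  have hlogQ := norm_mlog_sub_lin_le hQ (by linarith)
  have eL : mlog (P * Z * Q) - (mlog P + mlog Z + mlog Q)
      = (mlog (P * Z * Q) - (P * Z * Q - 1)) + (P * Z * Q - 1 - ((P - 1) + (Z - 1) + (Q - 1)))
        - ((mlog P - (P - 1)) + (mlog Z - (Z - 1)) + (mlog Q - (Q - 1))) := by abel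
  rw [eL]
  have hsq : ((p + z + q) + r2) ^ 2 ≤ (11 / 10 * (p + z + q)) ^ 2 :=
    pow_le_pow_left₀ (by positivity) hs 2
  have hsq3 : p ^ 2 + z ^ 2 + q ^ 2 ≤ (p + z + q) ^ 2 := by
    nlinarith [mul_nonneg hp0 hz0, mul_nonneg hp0 hq0, mul_nonneg hz0 hq0]
  calc _ ≤ ‖mlog (P * Z * Q) - (P * Z * Q - 1)‖ + ‖P * Z * Q - 1 - ((P - 1) + (Z - 1) + (Q - 1))‖
          + ‖(mlog P - (P - 1)) + (mlog Z - (Z - 1)) + (mlog Q - (Q - 1))‖ := norm_sub_le_of_le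
            (norm_add_le _ _) le_rfl
    _ ≤ 4 * ((p + z + q) + r2) ^ 2 + r2 + (4 * p ^ 2 + 4 * z ^ 2 + 4 * q ^ 2) := by
        gcongr
        exact (norm_add_le _ _).trans (add_le_add ((norm_add_le _ _).trans (add_le_add hlogP hlogZ)) hlogQ)
    _ ≤ 16 * (p + z + q) ^ 2 := by nlinarith

/-- [folklore] `‖e^a − 1 − a‖ ≤ α²` for `‖a‖ ≤ α ≤ 1`. -/
private theorem norm_exp_sub_one_sub_le_sq {a : 𝔸} {α : ℝ} (ha : ‖a‖ ≤ α) (hα : α ≤ 1) :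
    ‖exp a - 1 - a‖ ≤ α ^ 2 :=
  (norm_exp_sub_one_le_of_norm_le ha).2.trans (expRem_le_sq ((norm_nonneg _).trans ha) hα)

/-- [folklore] `‖e^a − 1‖ ≤ α + α²` for `‖a‖ ≤ α ≤ 1`. -/
private theorem norm_exp_sub_one_le_lin {a : 𝔸} {α : ℝ} (ha : ‖a‖ ≤ α) (hα : α ≤ 1) :
    ‖exp a - 1‖ ≤ α + α ^ 2 := by
  calc ‖exp a - 1‖ = ‖(exp a - 1 - a) + a‖ := by rw [sub_add_cancel]
    _ ≤ ‖exp a - 1 - a‖ + ‖a‖ := norm_add_le _ _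
    _ ≤ α ^ 2 + α := add_le_add (norm_exp_sub_one_sub_le_sq ha hα) ha
    _ = α + α ^ 2 := add_comm _ _

/-- [folklore] `‖e^a‖ ≤ e^{α}` for `‖a‖ ≤ α` (via `‖e^a − 1‖ ≤ e^α − 1`). -/
private theorem norm_exp_le_rexp [NormOneClass 𝔸] {a : 𝔸} {α : ℝ} (ha : ‖a‖ ≤ α) : ‖exp a‖ ≤ Real.exp α := by
  have h := norm_le_one_add (norm_exp_sub_one_le_of_norm_le ha).1
  linarith

/-- [folklore] **the exponential of a sum of three small terms and an error, against the product of the three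
exponentials, to second order**: `‖e^{a+b+c+e} − e^a e^b e^c‖ ≤ (α+β+γ+η)² + 3(α+β+γ)² + η` for `‖a‖ ≤ α`,
`‖b‖ ≤ β`, `‖c‖ ≤ γ`, `‖e‖ ≤ η`, `α + β + γ ≤ 1/4`, `η ≤ 1/4`. -/
private theorem norm_exp_add3_sub_le {a b c e : 𝔸} {α β γ η : ℝ} (ha : ‖a‖ ≤ α) (hb : ‖b‖ ≤ β)
    (hc : ‖c‖ ≤ γ) (he : ‖e‖ ≤ η) (hs : α + β + γ ≤ 1 / 4) (hη : η ≤ 1 / 4) :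
    ‖exp (a + b + c + e) - exp a * exp b * exp c‖ ≤ (α + β + γ + η) ^ 2 + 3 * (α + β + γ) ^ 2 + η := by
  have hα0 : 0 ≤ α := (norm_nonneg _).trans ha
  have hβ0 : 0 ≤ β := (norm_nonneg _).trans hb
  have hγ0 : 0 ≤ γ := (norm_nonneg _).trans hc
  have hη0 : 0 ≤ η := (norm_nonneg _).trans he
  have hx : ‖a + b + c + e‖ ≤ α + β + γ + η :=
    (norm_add_le _ _).trans (add_le_add ((norm_add_le _ _).trans (add_le_add ((norm_add_le _ _).trans
      (add_le_add ha hb)) hc)) he)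
  have h0 := norm_exp_sub_one_sub_le_sq hx (by linarith)
  have hga := norm_exp_sub_one_sub_le_sq ha (by linarith)
  have hgb := norm_exp_sub_one_sub_le_sq hb (by linarith)
  have hgc := norm_exp_sub_one_sub_le_sq hc (by linarith)
  have hGa : ‖exp a - 1‖ ≤ 2 * α := (norm_exp_sub_one_le_lin ha (by linarith)).trans (by nlinarith)
  have hGb : ‖exp b - 1‖ ≤ 2 * β := (norm_exp_sub_one_le_lin hb (by linarith)).trans (by nlinarith)
  have hGc : ‖exp c - 1‖ ≤ 2 * γ := (norm_exp_sub_one_le_lin hc (by linarith)).trans (by nlinarith)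
  have hT := norm_mul3_sub_one_sub_le (exp a) (exp b) (exp c)
  have hab : ‖exp a - 1‖ * ‖exp b - 1‖ ≤ (2 * α) * (2 * β) := mul_le_mul hGa hGb (norm_nonneg _) (by positivity)
  have hac : ‖exp a - 1‖ * ‖exp c - 1‖ ≤ (2 * α) * (2 * γ) := mul_le_mul hGa hGc (norm_nonneg _) (by positivity)
  have hbc : ‖exp b - 1‖ * ‖exp c - 1‖ ≤ (2 * β) * (2 * γ) := mul_le_mul hGb hGc (norm_nonneg _) (by positivity)
  have habc : ‖exp a - 1‖ * ‖exp b - 1‖ * ‖exp c - 1‖ ≤ (2 * α) * (2 * β) * (2 * γ) :=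
    mul_le_mul hab hGc (norm_nonneg _) (by positivity)
  have eE : exp (a + b + c + e) - exp a * exp b * exp c
      = (exp (a + b + c + e) - 1 - (a + b + c + e)) + e
        - (exp a * exp b * exp c - 1 - ((exp a - 1) + (exp b - 1) + (exp c - 1)))
        - ((exp a - 1 - a) + (exp b - 1 - b) + (exp c - 1 - c)) := by abel
  rw [eE]
  calc _ ≤ ‖(exp (a + b + c + e) - 1 - (a + b + c + e)) + e‖
          + ‖exp a * exp b * exp c - 1 - ((exp a - 1) + (exp b - 1) + (exp c - 1))‖
          + ‖(exp a - 1 - a) + (exp b - 1 - b) + (exp c - 1 - c)‖ :=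
        (norm_sub_le _ _).trans (add_le_add (norm_sub_le _ _) le_rfl)
    _ ≤ ((α + β + γ + η) ^ 2 + η)
          + ((2 * α) * (2 * β) + (2 * α) * (2 * γ) + (2 * β) * (2 * γ) + (2 * α) * (2 * β) * (2 * γ))
          + (α ^ 2 + β ^ 2 + γ ^ 2) := by
        gcongr
        · exact (norm_add_le _ _).trans (add_le_add h0 he)
        · exact hT.trans (by linarith)
        · exact (norm_add_le _ _).trans (add_le_add ((norm_add_le _ _).trans (add_le_add hga hgb)) hgc)
    _ ≤ (α + β + γ + η) ^ 2 + 3 * (α + β + γ) ^ 2 + η := by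
        have hγ4 : 2 * γ ≤ 1 := by linarith
        have h3 : (2 * α) * (2 * β) * (2 * γ) ≤ (2 * α) * (2 * β) * 1 :=
          mul_le_mul_of_nonneg_left hγ4 (by positivity)
        nlinarith [mul_nonneg hα0 hβ0, mul_nonneg hα0 hγ0, mul_nonneg hβ0 hγ0]

/-- [folklore] the final bookkeeping of § 6: `11000δ² + (1 + 13δ)(a + 226θ²) ≤ a + 500θ²` for `a ≤ δ`, `0 ≤ δ ≤ θ/8`,
`θ ≤ 1/64`. -/
private theorem numerics_final {δ θ a : ℝ} (hδ0 : 0 ≤ δ) (hθ1 : θ ≤ 1 / 64) (hδθ : 8 * δ ≤ θ)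
    (haδ : a ≤ δ) : 11000 * δ ^ 2 + (1 + 13 * δ) * (a + 226 * θ ^ 2) ≤ a + 500 * θ ^ 2 := by
  have hθ0 : 0 ≤ θ := by linarith
  have h1 : δ ^ 2 ≤ θ ^ 2 / 64 := by nlinarith [mul_le_mul hδθ hδθ (by positivity) hθ0]
  have h2 : δ * a ≤ δ ^ 2 := by nlinarith [mul_le_mul_of_nonneg_left haδ hδ0]
  have h3 : δ * θ ^ 2 ≤ θ ^ 2 / 512 := by
    have : δ ≤ 1 / 512 := by linarith
    exact (mul_le_mul_of_nonneg_right this (sq_nonneg θ)).trans_eq (by ring)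
  have e : (1 + 13 * δ) * (a + 226 * θ ^ 2) = a + 226 * θ ^ 2 + 13 * (δ * a) + 2938 * (δ * θ ^ 2) := by ring
  rw [e]
  nlinarith

end Toolkit

/-! ## § 1  Dictionary: the lineage's (0.12) average with the TREE contours IS [B7] (42)'s `bavg` -/

section Dictionary

variable {𝔸 : Type*} [NormedRing 𝔸] [NormedAlgebra ℂ 𝔸] [NormOneClass 𝔸] [CompleteSpace 𝔸] (L : ℕ)

/-- [cite: Balaban1985Averaging, (42) p.23] the average (0.12) built with the single TREE contour `Γ_{y,x}` of [2] (1.7)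
in place of the averaged contour variable `𝐔(y,x)` of (0.11) — i.e. [B7]'s average (42)/(15) on the b12 lineage's
`ℤᵈ` corner cubes: `M^tree_c(U) = exp[Σ_{x∈B(c₋)} L⁻ᵈ log U(Γ_{c₋,x})U([x,x′])U(Γ_{c₊,x′})⁻¹U(c)⁻¹]·U(c)`. -/
def avgT (U : ZdEdge d → 𝔸ˣ) (c : ZdEdge d) : 𝔸ˣ := avgM L (fun U : ZdEdge d → 𝔸ˣ => gammaT L U) U c

variable {L}

omit [NormedAlgebra ℂ 𝔸] [NormOneClass 𝔸] [CompleteSpace 𝔸] in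
/-- [folklore] a block sum as a sum over the corner-block vectors `r ∈ {0,…,L−1}ᵈ` of [B7] (2). -/
private theorem sum_blockSites_eq_sum_boxVec (hL : 0 < L) {β : Type*} [AddCommMonoid β] (y : Fin d → ℤ)
    (F : (Fin d → ℤ) → β) :
    ∑ x ∈ blockSites L y, F x = ∑ r : Fin d → Fin L, F (blockBase L y + boxVec L r) := by
  symm
  refine Finset.sum_bij (fun r _ => blockBase L y + boxVec L r) (fun r _ => ?_) (fun r₁ _ r₂ _ h => ?_)
    (fun x hx => ?_) (fun r _ => rfl)
  · refine mem_blockSites_of_bounds hL fun i => ?_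
    have h1 := (r i).isLt
    simp only [Pi.add_apply, boxVec]
    constructor <;> omega
  · funext i
    have := congr_fun h i
    simp only [Pi.add_apply, boxVec, add_right_inj, Nat.cast_inj] at this
    exact Fin.ext this
  · obtain ⟨r, hr⟩ := exists_boxVec hx
    exact ⟨r, mem_univ _, by rw [← hr]; abel⟩

omit [NormOneClass 𝔸] [CompleteSpace 𝔸] in
/-- [folklore] the complex weight `L⁻ᵈ` acts as the real weight `L⁻ᵈ`. -/
private theorem weight_smul_eq (a : 𝔸) : ((L : ℂ) ^ d)⁻¹ • a = ((L : ℝ) ^ d)⁻¹ • a := by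
  rw [show ((L : ℂ) ^ d)⁻¹ = ((((L : ℝ) ^ d)⁻¹ : ℝ) : ℂ) by push_cast; rfl, Complex.coe_smul]

omit [NormOneClass 𝔸] in
/-- [cite: Balaban1985Averaging, (42) p.23] **DICTIONARY**: the lineage's tree-contour average `avgT` IS [B7] (42)'s
block average `B7Prop1Explicit.bavg` of the curried configuration, on the coarse bond `c = ⟨y, y + e_μ⟩` read at the
base point `L·y` (`loopW_gammaT_eq_Wcx`, `hol_seg_eq_lineR`; the axis loops are `1` on both sides). -/
theorem avgT_eq_bavg (hL : 0 < L) (U : ZdEdge d → 𝔸ˣ) (c : ZdEdge d) :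
    avgT L U c = bavg L (Function.curry U) (blockBase L c.1) c.2 := by
  apply Units.ext
  have hS : Ustr L U c = hol (Function.curry U) (blockBase L c.1) (seg c.2 (L : ℤ)) := by
    rw [Ustr, ← hol_seg_eq_lineR]
  have hsum : ∑ x ∈ blockSites L c.1, ((L : ℂ) ^ d)⁻¹ •
        mlog ((loopW L (fun U : ZdEdge d → 𝔸ˣ => gammaT L U) U c x : 𝔸ˣ) : 𝔸)
      = Xavg L (Function.curry U) (blockBase L c.1) c.2 := by
    unfold Xavg
    rw [sum_blockSites_eq_sum_boxVec hL]
    refine sum_congr rfl fun r _ => ?_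
    have hmem : blockBase L c.1 + boxVec L r ∈ blockSites L c.1 := by
      refine mem_blockSites_of_bounds hL fun i => ?_
      have h1 := (r i).isLt
      simp only [Pi.add_apply, boxVec]
      constructor <;> omega
    rw [loopW_gammaT_eq_Wcx hL U c hmem, add_sub_cancel_left, weight_smul_eq]
  unfold avgT avgM bavg
  rw [Units.val_mul, Units.val_mul, val_expU, val_expUnit, hsum, hS]

omit [NormOneClass 𝔸] in
/-- [cite: Balaban1985Averaging, (44) p.24] the coarse plaquette variable of the tree average is [B7]'s `cplaq` of
`bavg` at the base point `L·y` (`L(y + e_μ) = Ly + Le_μ`). -/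
theorem plaq_avgT_eq_cplaq (hL : 0 < L) (U : ZdEdge d → 𝔸ˣ) (y : Fin d → ℤ) (μ ν : Fin d) :
    plaquetteHolonomyZd (avgT L U) y μ ν = cplaq L (bavg L (Function.curry U)) (blockBase L y) μ ν := by
  simp only [plaquetteHolonomyZd, cplaq, avgT_eq_bavg hL, blockBase_add_single, zsmul_e]

/-- [cite: Balaban1985Averaging, Prop. 1 (51) p.26] **[B7] PROPOSITION 1 FOR THE TREE-CONTOUR AVERAGE OF THE LINEAGE**
(transport of `B7Prop1Explicit.prop1_explicit` along the dictionary): under plaquette regularity `‖U(∂p) − 1‖ ≤ α₀`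
on `ℤᵈ`, `U1`-valued `U` and `512(d+1)(d+4)L²α₀ ≤ 1`,
`‖M^tree(∂p′) − 1‖ ≤ L²α₀ + 226·(8(d+1)(d+4)L²α₀)²` for every plaquette `p′` of the coarse lattice. -/
theorem prop1_avgT (hL : 0 < L) (U : ZdEdge d → 𝔸ˣ) (hU : ∀ b, U b ∈ U1 𝔸) {α₀ : ℝ} (hα₀ : 0 ≤ α₀)
    (hsmall : 512 * (d + 1) * (d + 4) * (L : ℝ) ^ 2 * α₀ ≤ 1)
    (h44 : ∀ (p : Fin d → ℤ) (i j : Fin d), i ≠ j → ‖((plaquetteHolonomyZd U p i j : 𝔸ˣ) : 𝔸) - 1‖ ≤ α₀)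
    (y : Fin d → ℤ) {μ ν : Fin d} (hμν : μ ≠ ν) :
    ‖((plaquetteHolonomyZd (avgT L U) y μ ν : 𝔸ˣ) : 𝔸) - 1‖
      ≤ (L : ℝ) ^ 2 * α₀ + 226 * (8 * (d + 1) * (d + 4) * (L : ℝ) ^ 2 * α₀) ^ 2 := by
  rw [plaq_avgT_eq_cplaq hL]
  refine prop1_explicit L hL (blockBase L y) hμν (Function.curry U) (fun x κ => hU (x, κ)) hα₀ hsmall
    fun x κ κ' hκ => ?_
  rw [hol_curry_plaqWord]
  exact h44 x κ κ' hκ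

end Dictionary

/-! ## § 2  The Federbush factors `X(x) = U(Γ_{q,x})·𝐔(q,x)⁻¹` of (0.11) and their block means `Ξ(y)` -/

section Federbush

variable {𝔸 : Type*} [NormedRing 𝔸] [NormedAlgebra ℂ 𝔸] [NormOneClass 𝔸] [CompleteSpace 𝔸] (L : ℕ)

/-- [cite: Balaban1987RG1, (0.11) p.253] the FEDERBUSH FACTOR of the averaged contour variable: the unit `X(x)`
with `𝐔(q,x) = X(x)⁻¹ U(Γ_{q,x})` (the tree's local solution of (0.10) for the relative family
`{U(Γ^π_{q,x})U(Γ_{q,x})⁻¹}_π`, `B12ContourAverage253.Tavg_eq`). -/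
def fedX (U : ZdEdge d → 𝔸ˣ) (x : Fin d → ℤ) : 𝔸ˣ :=
  fedUnit (rel (fun π : Equiv.Perm (Fin d) => permT L U π x) 1)

/-- [cite: Balaban1987RG1, (0.11) p.253] its logarithm `ξ(x) = log X(x)` (series logarithm). -/
def xi (U : ZdEdge d → 𝔸ˣ) (x : Fin d → ℤ) : 𝔸 := mlog ((fedX L U x : 𝔸ˣ) : 𝔸)

/-- [cite: Balaban1987RG1, (0.12) p.254] the BLOCK MEAN of the Federbush logarithms, `Ξ(y) = Σ_{x∈B(y)} L⁻ᵈ ξ(x)`: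
the exponent of the coarse gauge transformation relating, to second order, the (0.12) average over the (0.11) variables
to the (0.12) average over the tree contours (§ 4). -/
def Xi (U : ZdEdge d → 𝔸ˣ) (y : Fin d → ℤ) : 𝔸 := ∑ x ∈ blockSites L y, ((L : ℂ) ^ d)⁻¹ • xi L U x

variable {L}

omit [NormOneClass 𝔸] in
/-- [cite: Balaban1987RG1, (0.11) p.253] `𝐔(q,x) = X(x)⁻¹ · U(Γ_{q,x})`. -/
theorem Tavg_eq_fedX_inv_mul (hL : 0 < L) (U : ZdEdge d → 𝔸ˣ) (x : Fin d → ℤ) :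
    Tavg L U x = (fedX L U x)⁻¹ * gammaT L U x := Tavg_eq hL U x

/-- [cite: Balaban1987RG1, (0.11) p.253] `‖X(x) − 1‖ ≤ 3(dL)²ε₀` and `‖X(x)⁻¹ − 1‖ ≤ 4(dL)²ε₀` on an `ε₀`-regular
configuration with `(dL)²ε₀ ≤ 1/100` (`B12ContourAverage253` § 2–§ 3: the relative family has diameter `(dL)²ε₀`). -/
theorem norm_fedX_sub_one_le (hL : 0 < L) (U : ZdEdge d → 𝔸ˣ) (hU : ∀ b, U b ∈ U1 𝔸) {ε₀ : ℝ} (hε₀ : 0 ≤ ε₀)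
    (hsm : ((d : ℝ) * L) ^ 2 * ε₀ ≤ 1 / 100)
    (h44 : ∀ (p : Fin d → ℤ) (i j : Fin d), i ≠ j → ‖((plaquetteHolonomyZd U p i j : 𝔸ˣ) : 𝔸) - 1‖ ≤ ε₀)
    {y x : Fin d → ℤ} (hx : x ∈ blockSites L y) :
    ‖((fedX L U x : 𝔸ˣ) : 𝔸) - 1‖ ≤ 3 * (((d : ℝ) * L) ^ 2 * ε₀) ∧
      ‖(((fedX L U x)⁻¹ : 𝔸ˣ) : 𝔸) - 1‖ ≤ 4 * (((d : ℝ) * L) ^ 2 * ε₀) := by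
  have hxhi : x ≤ blockBase L y + fun _ => (L : ℤ) - 1 := fun i => by
    have := (bounds_of_mem_blockSites hx i).2
    simp only [Pi.add_apply]
    omega
  have hR : ∀ π, ‖rel (fun π : Equiv.Perm (Fin d) => permT L U π x) 1 π - 1‖ ≤ ((d : ℝ) * L) ^ 2 * ε₀ :=
    fun π => by
      simp only [rel, permT_one hL, ← Units.val_mul]
      exact norm_permT_mul_gammaT_inv_sub_one_le hL U (fun b => (mem_U1.mp (hU b)).1)
        (fun b => (mem_U1.mp (hU b)).2) hε₀ hx le_rfl hxhi (fun p i j hij _ _ => h44 p i j hij) π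
  refine ⟨?_, ?_⟩
  · rw [fedX, val_fedUnit]
    exact norm_fedSol_sub_one_le hsm hR
  · rw [fedX, ← fedAvg_mul_inv]
    exact B12ContourAverage253.norm_fedAvg_mul_inv_sub_one_le hsm hR

omit [NormOneClass 𝔸] in
/-- [cite: Balaban1987RG1, (0.11) p.253] on the axis lines of a block all contours of `𝐆(q,x)` coincide, the relative
family is constant `1`, so `X = 1` there. -/
theorem fedX_axis (hL : 0 < L) (U : ZdEdge d → 𝔸ˣ) (y : Fin d → ℤ) (μ : Fin d) {t : ℕ} (ht : t < L) :
    fedX L U (blockBase L y + Pi.single μ (t : ℤ)) = 1 := by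
  apply Units.ext
  rw [fedX, val_fedUnit, Units.val_one]
  have h : rel (fun π : Equiv.Perm (Fin d) => permT L U π (blockBase L y + Pi.single μ (t : ℤ))) 1
      = fun _ => (1 : 𝔸) := by
    funext π
    simp only [rel, permT_axis hL U y μ ht, Units.mul_inv]
  rw [h]
  exact fedSol_const_one

/-- [cite: Balaban1987RG1, (0.11) p.253] `log X(x)⁻¹ = −ξ(x)` (series logarithm of the inverse, `‖X − 1‖ ≤ 1/3`). -/
theorem mlog_fedX_inv (hL : 0 < L) (U : ZdEdge d → 𝔸ˣ) (hU : ∀ b, U b ∈ U1 𝔸) {ε₀ : ℝ} (hε₀ : 0 ≤ ε₀)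
    (hsm : ((d : ℝ) * L) ^ 2 * ε₀ ≤ 1 / 100)
    (h44 : ∀ (p : Fin d → ℤ) (i j : Fin d), i ≠ j → ‖((plaquetteHolonomyZd U p i j : 𝔸ˣ) : 𝔸) - 1‖ ≤ ε₀)
    {y x : Fin d → ℤ} (hx : x ∈ blockSites L y) :
    mlog ((((fedX L U x)⁻¹ : 𝔸ˣ)) : 𝔸) = -xi L U x := by
  have h := (norm_fedX_sub_one_le hL U hU hε₀ hsm h44 hx).1
  exact ExpMeanLog.mlog_eq_neg_of_mul_eq_one (Units.mul_inv _) (h.trans (by linarith))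

/-- [cite: Balaban1987RG1, (0.11) p.253] `‖ξ(x)‖ ≤ 6(dL)²ε₀` (`‖log X‖ ≤ 2‖X − 1‖`). -/
theorem norm_xi_le (hL : 0 < L) (U : ZdEdge d → 𝔸ˣ) (hU : ∀ b, U b ∈ U1 𝔸) {ε₀ : ℝ} (hε₀ : 0 ≤ ε₀)
    (hsm : ((d : ℝ) * L) ^ 2 * ε₀ ≤ 1 / 100)
    (h44 : ∀ (p : Fin d → ℤ) (i j : Fin d), i ≠ j → ‖((plaquetteHolonomyZd U p i j : 𝔸ˣ) : 𝔸) - 1‖ ≤ ε₀)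
    {y x : Fin d → ℤ} (hx : x ∈ blockSites L y) :
    ‖xi L U x‖ ≤ 6 * (((d : ℝ) * L) ^ 2 * ε₀) := by
  have h := (norm_fedX_sub_one_le hL U hU hε₀ hsm h44 hx).1
  exact (norm_mlog_le_two_mul (h.trans (by linarith))).trans (by linarith)

omit [NormOneClass 𝔸] [CompleteSpace 𝔸] in
/-- [folklore] `‖L⁻ᵈ • v‖ = L⁻ᵈ‖v‖`. -/
private theorem norm_weight_smul (v : 𝔸) : ‖((L : ℂ) ^ d)⁻¹ • v‖ = ((L : ℝ) ^ d)⁻¹ * ‖v‖ := by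
  rw [norm_smul, norm_inv, norm_pow, Complex.norm_natCast]

omit [NormedRing 𝔸] [NormedAlgebra ℂ 𝔸] [NormOneClass 𝔸] [CompleteSpace 𝔸] in
/-- [folklore] the weights of a block sum to `1`. -/
private theorem sum_blockSites_weight (hL : 0 < L) (y : Fin d → ℤ) :
    ∑ _x ∈ blockSites L y, ((L : ℝ) ^ d)⁻¹ = 1 := by
  rw [sum_const, card_blockSites, nsmul_eq_mul]
  have hLd : (0 : ℝ) < (L : ℝ) ^ d := by positivity
  push_cast
  exact mul_inv_cancel₀ hLd.ne'

omit [NormOneClass 𝔸] [CompleteSpace 𝔸] in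
/-- [folklore] **a weighted block mean is bounded by the bound of its terms**:
`‖Σ_{x∈B(y)} L⁻ᵈ • F(x)‖ ≤ K` if `‖F(x)‖ ≤ K` on `B(y)`. -/
private theorem norm_blockMean_le (hL : 0 < L) {y : Fin d → ℤ} {F : (Fin d → ℤ) → 𝔸} {K : ℝ}
    (hF : ∀ x ∈ blockSites L y, ‖F x‖ ≤ K) :
    ‖∑ x ∈ blockSites L y, ((L : ℂ) ^ d)⁻¹ • F x‖ ≤ K := by
  calc _ ≤ ∑ x ∈ blockSites L y, ‖((L : ℂ) ^ d)⁻¹ • F x‖ := norm_sum_le _ _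
    _ ≤ ∑ _x ∈ blockSites L y, ((L : ℝ) ^ d)⁻¹ * K := by
        refine sum_le_sum fun x hx => ?_
        rw [norm_weight_smul]
        exact mul_le_mul_of_nonneg_left (hF x hx) (by positivity)
    _ = K := by rw [← sum_mul, sum_blockSites_weight hL, one_mul]

/-- [cite: Balaban1987RG1, (0.12) p.254] `‖Ξ(y)‖ ≤ 6(dL)²ε₀` (a weighted mean of the `ξ(x)`). -/
theorem norm_Xi_le (hL : 0 < L) (U : ZdEdge d → 𝔸ˣ) (hU : ∀ b, U b ∈ U1 𝔸) {ε₀ : ℝ} (hε₀ : 0 ≤ ε₀)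
    (hsm : ((d : ℝ) * L) ^ 2 * ε₀ ≤ 1 / 100)
    (h44 : ∀ (p : Fin d → ℤ) (i j : Fin d), i ≠ j → ‖((plaquetteHolonomyZd U p i j : 𝔸ˣ) : 𝔸) - 1‖ ≤ ε₀)
    (y : Fin d → ℤ) : ‖Xi L U y‖ ≤ 6 * (((d : ℝ) * L) ^ 2 * ε₀) :=
  norm_blockMean_le hL fun _ hx => norm_xi_le hL U hU hε₀ hsm h44 hx

omit [NormedRing 𝔸] [NormedAlgebra ℂ 𝔸] [NormOneClass 𝔸] [CompleteSpace 𝔸] in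
/-- [cite: Balaban1984PropagatorsI, (1.8) p.19] re-indexing a block sum along `x ↦ x(c) = x + Le_μ`,
`B(y + e_μ) = B(y) + Le_μ`. -/
theorem sum_blockSites_succ (hL : 0 < L) {β : Type*} [AddCommMonoid β] (y : Fin d → ℤ) (μ : Fin d)
    (F : (Fin d → ℤ) → β) :
    ∑ x ∈ blockSites L (y + Pi.single μ 1), F x = ∑ x ∈ blockSites L y, F (x + Pi.single μ (L : ℤ)) := by
  rw [blockSites_add_single L hL y μ 1, mul_one, sum_image]
  intro x _ x' _ h
  exact add_right_cancel h

omit [NormOneClass 𝔸] in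
/-- [cite: Balaban1987RG1, (0.12) p.254] `Ξ(c₊) = Σ_{x∈B(c₋)} L⁻ᵈ ξ(x(c))`, `x(c) = x + Le_μ`. -/
theorem Xi_succ (hL : 0 < L) (U : ZdEdge d → 𝔸ˣ) (y : Fin d → ℤ) (μ : Fin d) :
    Xi L U (y + Pi.single μ 1) = ∑ x ∈ blockSites L y, ((L : ℂ) ^ d)⁻¹ • xi L U (x + Pi.single μ (L : ℤ)) := by
  unfold Xi
  rw [sum_blockSites_succ hL]

end Federbush

/-! ## § 3  The (0.12) loop of the averaged variables against the tree loop: logarithms to second order -/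

section Logs

variable {𝔸 : Type*} [NormedRing 𝔸] [NormedAlgebra ℂ 𝔸] [NormOneClass 𝔸] [CompleteSpace 𝔸] {L : ℕ}

omit [NormOneClass 𝔸] in
/-- [cite: Balaban1987RG1, (0.12) p.254] **factorisation of the (0.12) loop through the tree loop**: with
`𝐔(c₋,x) = X(x)⁻¹U(Γ_{c₋,x})`, `𝐔(c₊,x′) = X(x′)⁻¹U(Γ_{c₊,x′})`,
`W^avg_x = X(x)⁻¹ · W^tree_x · (U(c) X(x′) U(c)⁻¹)` (`B12ContourAverage253.loop_factor`). -/
theorem loopW_Tavg_factor (hL : 0 < L) (U : ZdEdge d → 𝔸ˣ) (c : ZdEdge d) (x : Fin d → ℤ) :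
    loopW L (fun U : ZdEdge d → 𝔸ˣ => Tavg L U) U c x =
      (fedX L U x)⁻¹ * loopW L (fun U : ZdEdge d → 𝔸ˣ => gammaT L U) U c x *
        (Ustr L U c * fedX L U (x + Pi.single c.2 (L : ℤ)) * (Ustr L U c)⁻¹) := by
  rw [loopW_def, loopW_def, Tavg_eq hL, Tavg_eq hL]
  exact loop_factor _ _ _ _ _ _

omit [NormedAlgebra ℂ 𝔸] [CompleteSpace 𝔸] in
/-- [cite: Balaban1987RG1, (0.12) p.254] the straight holonomy `U(c) = U([Lc₋, Lc₊])` lies in `U1`. -/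
theorem Ustr_mem_U1 (U : ZdEdge d → 𝔸ˣ) (hU : ∀ b, U b ∈ U1 𝔸) (c : ZdEdge d) : Ustr L U c ∈ U1 𝔸 := by
  rw [Ustr, ← hol_seg_eq_lineR]
  exact hol_mem (fun x κ => hU (x, κ)) _ _

omit [NormedAlgebra ℂ 𝔸] [CompleteSpace 𝔸] in
/-- [cite: Balaban1985Averaging, pp.24–25] the tree loop is `(dL)²ε₀`-close to `1` on an `ε₀`-regular configuration
(`B12PlaquetteLoop267.norm_loopW_sub_one_le_local`, `ω(ε₀) ≤ (dL)²ε₀`). -/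
theorem norm_loopW_gammaT_sub_one_le (hL : 0 < L) (hd : 1 ≤ d) (U : ZdEdge d → 𝔸ˣ) (hU : ∀ b, U b ∈ U1 𝔸)
    {ε₀ : ℝ} (hε₀ : 0 ≤ ε₀)
    (h44 : ∀ (p : Fin d → ℤ) (i j : Fin d), i ≠ j → ‖((plaquetteHolonomyZd U p i j : 𝔸ˣ) : 𝔸) - 1‖ ≤ ε₀)
    (c : ZdEdge d) {x : Fin d → ℤ} (hx : x ∈ blockSites L c.1) :
    ‖((loopW L (fun U : ZdEdge d → 𝔸ˣ => gammaT L U) U c x : 𝔸ˣ) : 𝔸) - 1‖ ≤ ((d : ℝ) * L) ^ 2 * ε₀ :=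
  (norm_loopW_sub_one_le_local hL U (fun b => (mem_U1.mp (hU b)).1) (fun b => (mem_U1.mp (hU b)).2) hε₀ c
    (fun p i j hij _ _ => h44 p i j hij) hx).trans (omegaC_le hL hd hε₀)

/-- [cite: Balaban1987RG1, p.254] **THE LOGARITHM OF THE (0.12) LOOP OF THE AVERAGED VARIABLES TO SECOND ORDER**
(«properties similar to the properties of the average introduced in (0.4)»): for `x ∈ B(c₋)`, `x′ = x + Le_μ`,
`log W^avg_x = −ξ(x) + log W^tree_x + U(c) ξ(x′) U(c)⁻¹ + E_x` with `‖E_x‖ ≤ 1024·((dL)²ε₀)²`, on an `ε₀`-regular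
`U1`-valued configuration with `(dL)²ε₀ ≤ 1/100` (the three factors of `loopW_Tavg_factor` are within `4δ`, `δ`,
`3δ` of `1`, `δ = (dL)²ε₀`; `log X⁻¹ = −log X`, `log(uXu⁻¹) = u(log X)u⁻¹`). -/
theorem norm_mlog_loopW_Tavg_sub_le (hL : 0 < L) (hd : 1 ≤ d) (U : ZdEdge d → 𝔸ˣ) (hU : ∀ b, U b ∈ U1 𝔸)
    {ε₀ : ℝ} (hε₀ : 0 ≤ ε₀) (hsm : ((d : ℝ) * L) ^ 2 * ε₀ ≤ 1 / 100)
    (h44 : ∀ (p : Fin d → ℤ) (i j : Fin d), i ≠ j → ‖((plaquetteHolonomyZd U p i j : 𝔸ˣ) : 𝔸) - 1‖ ≤ ε₀)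
    (c : ZdEdge d) {x : Fin d → ℤ} (hx : x ∈ blockSites L c.1) :
    ‖mlog ((loopW L (fun U : ZdEdge d → 𝔸ˣ => Tavg L U) U c x : 𝔸ˣ) : 𝔸)
        - (-xi L U x + mlog ((loopW L (fun U : ZdEdge d → 𝔸ˣ => gammaT L U) U c x : 𝔸ˣ) : 𝔸)
            + ((Ustr L U c : 𝔸ˣ) : 𝔸) * xi L U (x + Pi.single c.2 (L : ℤ)) * (((Ustr L U c)⁻¹ : 𝔸ˣ) : 𝔸))‖
      ≤ 1024 * (((d : ℝ) * L) ^ 2 * ε₀) ^ 2 := by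
  set δ : ℝ := ((d : ℝ) * L) ^ 2 * ε₀ with hδ
  have hx' : x + Pi.single c.2 (L : ℤ) ∈ blockSites L (c.1 + Pi.single c.2 1) := add_mem_blockSites_succ hL c.2 hx
  have hS : Ustr L U c ∈ U1 𝔸 := Ustr_mem_U1 U hU c
  obtain ⟨hX3, hP⟩ := norm_fedX_sub_one_le hL U hU hε₀ hsm h44 hx
  have hX'3 := (norm_fedX_sub_one_le hL U hU hε₀ hsm h44 hx').1
  have hZ := norm_loopW_gammaT_sub_one_le hL hd U hU hε₀ h44 c hx
  have hQ : ‖((Ustr L U c : 𝔸ˣ) : 𝔸) * ((fedX L U (x + Pi.single c.2 (L : ℤ)) : 𝔸ˣ) : 𝔸) * (((Ustr L U c)⁻¹ : 𝔸ˣ) : 𝔸) - 1‖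
      ≤ 3 * δ := (norm_units_conj_sub_one_le hS _).trans hX'3
  have hmain := norm_mlog_mul3_sub_le hP hZ hQ (by rw [← hδ]; linarith)
  -- the two exact logarithms
  have hlogP : mlog ((((fedX L U x)⁻¹ : 𝔸ˣ)) : 𝔸) = -xi L U x := mlog_fedX_inv hL U hU hε₀ hsm h44 hx
  have hlogQ : mlog (((Ustr L U c : 𝔸ˣ) : 𝔸) * ((fedX L U (x + Pi.single c.2 (L : ℤ)) : 𝔸ˣ) : 𝔸) * (((Ustr L U c)⁻¹ : 𝔸ˣ) : 𝔸))
      = ((Ustr L U c : 𝔸ˣ) : 𝔸) * xi L U (x + Pi.single c.2 (L : ℤ)) * (((Ustr L U c)⁻¹ : 𝔸ˣ) : 𝔸) := by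
    rw [xi]
    exact mlog_units_conj hS (hX'3.trans_lt (by linarith))
  rw [loopW_Tavg_factor hL, Units.val_mul, Units.val_mul, Units.val_mul, Units.val_mul, ← hlogP, ← hlogQ]
  refine hmain.trans ?_
  have : (4 * δ + δ + 3 * δ) = 8 * δ := by ring
  rw [this]
  nlinarith [sq_nonneg δ]

end Logs

/-! ## § 4  Block sums: the exponent of (0.12) over the averaged variables is
`−Ξ(c₋) + X^tree_c + U(c)Ξ(c₊)U(c)⁻¹` to second order -/

section Exponent

variable {𝔸 : Type*} [NormedRing 𝔸] [NormedAlgebra ℂ 𝔸] [NormOneClass 𝔸] [CompleteSpace 𝔸] (L : ℕ)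

/-- [cite: Balaban1987RG1, (0.12) p.254] the exponent of (0.12) for a transporter family `𝒯`:
`A_𝒯(c) = Σ_{x∈B(c₋)} L⁻ᵈ log W^𝒯_x` (so that `M_c = exp[A_𝒯(c)]·U(c)`, `B12AverageCorridor267.avgM`). -/
def expo (𝒯 : (ZdEdge d → 𝔸ˣ) → (Fin d → ℤ) → 𝔸ˣ) (U : ZdEdge d → 𝔸ˣ) (c : ZdEdge d) : 𝔸 :=
  ∑ x ∈ blockSites L c.1, ((L : ℂ) ^ d)⁻¹ • mlog ((loopW L 𝒯 U c x : 𝔸ˣ) : 𝔸)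

/-- [cite: Balaban1987RG1, (0.12) p.254] the second-order REMAINDER of the exponent comparison:
`E(c) = A_avg(c) − [−Ξ(c₋) + A_tree(c) + U(c)Ξ(c₊)U(c)⁻¹]`. -/
def Erem (U : ZdEdge d → 𝔸ˣ) (c : ZdEdge d) : 𝔸 :=
  expo L (fun U : ZdEdge d → 𝔸ˣ => Tavg L U) U c
    - (-Xi L U c.1 + expo L (fun U : ZdEdge d → 𝔸ˣ => gammaT L U) U c
        + ((Ustr L U c : 𝔸ˣ) : 𝔸) * Xi L U (c.1 + Pi.single c.2 1) * (((Ustr L U c)⁻¹ : 𝔸ˣ) : 𝔸))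

variable {L}

omit [NormOneClass 𝔸] in
/-- [cite: Balaban1987RG1, (0.12) p.254] `Ū(c) = exp[A_avg(c)]·U(c)` (unfolding `avgBar`/`avgM`). -/
theorem val_avgBar (U : ZdEdge d → 𝔸ˣ) (c : ZdEdge d) :
    ((avgBar L U c : 𝔸ˣ) : 𝔸) = exp (expo L (fun U : ZdEdge d → 𝔸ˣ => Tavg L U) U c) * ((Ustr L U c : 𝔸ˣ) : 𝔸) := rfl

omit [NormOneClass 𝔸] in
/-- [cite: Balaban1985Averaging, (42) p.23] `M^tree(c) = exp[A_tree(c)]·U(c)`. -/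
theorem val_avgT (U : ZdEdge d → 𝔸ˣ) (c : ZdEdge d) :
    ((avgT L U c : 𝔸ˣ) : 𝔸) = exp (expo L (fun U : ZdEdge d → 𝔸ˣ => gammaT L U) U c) * ((Ustr L U c : 𝔸ˣ) : 𝔸) := rfl

omit [NormOneClass 𝔸] in
/-- [cite: Balaban1987RG1, (0.12) p.254] the exponent identity `A_avg(c) = −Ξ(c₋) + A_tree(c) + U(c)Ξ(c₊)U(c)⁻¹ + E(c)`. -/
theorem expo_Tavg_eq (U : ZdEdge d → 𝔸ˣ) (c : ZdEdge d) :
    expo L (fun U : ZdEdge d → 𝔸ˣ => Tavg L U) U c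
      = -Xi L U c.1 + expo L (fun U : ZdEdge d → 𝔸ˣ => gammaT L U) U c
        + ((Ustr L U c : 𝔸ˣ) : 𝔸) * Xi L U (c.1 + Pi.single c.2 1) * (((Ustr L U c)⁻¹ : 𝔸ˣ) : 𝔸) + Erem L U c := by
  rw [Erem]; abel

omit [NormOneClass 𝔸] [CompleteSpace 𝔸] in
/-- [folklore] conjugating a weighted sum termwise. -/
private theorem conj_blockSum (S : 𝔸ˣ) (y : Fin d → ℤ) (F : (Fin d → ℤ) → 𝔸) :
    (S : 𝔸) * (∑ x ∈ blockSites L y, ((L : ℂ) ^ d)⁻¹ • F x) * ((S⁻¹ : 𝔸ˣ) : 𝔸)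
      = ∑ x ∈ blockSites L y, ((L : ℂ) ^ d)⁻¹ • ((S : 𝔸) * F x * ((S⁻¹ : 𝔸ˣ) : 𝔸)) := by
  rw [mul_sum, sum_mul]
  refine sum_congr rfl fun x _ => ?_
  rw [mul_smul_comm, smul_mul_assoc]

omit [NormOneClass 𝔸] in
/-- [cite: Balaban1987RG1, (0.12) p.254] the remainder is the block mean of the per-site remainders of § 3. -/
theorem Erem_eq_sum (hL : 0 < L) (U : ZdEdge d → 𝔸ˣ) (c : ZdEdge d) :
    Erem L U c = ∑ x ∈ blockSites L c.1, ((L : ℂ) ^ d)⁻¹ •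
      (mlog ((loopW L (fun U : ZdEdge d → 𝔸ˣ => Tavg L U) U c x : 𝔸ˣ) : 𝔸)
        - (-xi L U x + mlog ((loopW L (fun U : ZdEdge d → 𝔸ˣ => gammaT L U) U c x : 𝔸ˣ) : 𝔸)
            + ((Ustr L U c : 𝔸ˣ) : 𝔸) * xi L U (x + Pi.single c.2 (L : ℤ)) * (((Ustr L U c)⁻¹ : 𝔸ˣ) : 𝔸))) := by
  unfold Erem expo
  rw [Xi_succ hL, conj_blockSum, Xi]
  simp only [smul_sub, smul_add, smul_neg, sum_sub_distrib, sum_add_distrib, sum_neg_distrib]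

/-- [cite: Balaban1987RG1, p.254] **THE EXPONENT OF (0.12) OVER THE AVERAGED VARIABLES TO SECOND ORDER**:
`‖E(c)‖ ≤ 1024·((dL)²ε₀)²` on an `ε₀`-regular `U1`-valued configuration with `(dL)²ε₀ ≤ 1/100`. -/
theorem norm_Erem_le (hL : 0 < L) (hd : 1 ≤ d) (U : ZdEdge d → 𝔸ˣ) (hU : ∀ b, U b ∈ U1 𝔸)
    {ε₀ : ℝ} (hε₀ : 0 ≤ ε₀) (hsm : ((d : ℝ) * L) ^ 2 * ε₀ ≤ 1 / 100)
    (h44 : ∀ (p : Fin d → ℤ) (i j : Fin d), i ≠ j → ‖((plaquetteHolonomyZd U p i j : 𝔸ˣ) : 𝔸) - 1‖ ≤ ε₀)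
    (c : ZdEdge d) : ‖Erem L U c‖ ≤ 1024 * (((d : ℝ) * L) ^ 2 * ε₀) ^ 2 := by
  rw [Erem_eq_sum hL]
  exact norm_blockMean_le hL fun x hx => norm_mlog_loopW_Tavg_sub_le hL hd U hU hε₀ hsm h44 c hx

/-- [cite: Balaban1985Averaging, (47) p.25] `‖A_tree(c)‖ ≤ 2(dL)²ε₀` (every tree loop is `(dL)²ε₀`-close to `1`,
`‖log W‖ ≤ 2‖W − 1‖`). -/
theorem norm_expo_gammaT_le (hL : 0 < L) (hd : 1 ≤ d) (U : ZdEdge d → 𝔸ˣ) (hU : ∀ b, U b ∈ U1 𝔸)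
    {ε₀ : ℝ} (hε₀ : 0 ≤ ε₀) (hsm : ((d : ℝ) * L) ^ 2 * ε₀ ≤ 1 / 100)
    (h44 : ∀ (p : Fin d → ℤ) (i j : Fin d), i ≠ j → ‖((plaquetteHolonomyZd U p i j : 𝔸ˣ) : 𝔸) - 1‖ ≤ ε₀)
    (c : ZdEdge d) :
    ‖expo L (fun U : ZdEdge d → 𝔸ˣ => gammaT L U) U c‖ ≤ 2 * (((d : ℝ) * L) ^ 2 * ε₀) := by
  refine norm_blockMean_le hL fun x hx => ?_
  have h := norm_loopW_gammaT_sub_one_le hL hd U hU hε₀ h44 c hx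
  exact (norm_mlog_le_two_mul (h.trans (by linarith))).trans (by linarith)

/-- [cite: Balaban1987RG1, (0.12) p.254] `‖A_avg(c)‖ ≤ 2ω_A(ε₀) = 20(dL)²ε₀` (every (0.12) loop of the averaged
variables is `ω_A`-close to `1`, `B12ContourAverage253.norm_loopW_Tavg_sub_one_le_local`). -/
theorem norm_expo_Tavg_le (hL : 0 < L) (hd : 1 ≤ d) (U : ZdEdge d → 𝔸ˣ) (hU : ∀ b, U b ∈ U1 𝔸)
    {ε₀ : ℝ} (hε₀ : 0 ≤ ε₀) (hsm : ((d : ℝ) * L) ^ 2 * ε₀ ≤ 1 / 100)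
    (h44 : ∀ (p : Fin d → ℤ) (i j : Fin d), i ≠ j → ‖((plaquetteHolonomyZd U p i j : 𝔸ˣ) : 𝔸) - 1‖ ≤ ε₀)
    (c : ZdEdge d) :
    ‖expo L (fun U : ZdEdge d → 𝔸ˣ => Tavg L U) U c‖ ≤ 20 * (((d : ℝ) * L) ^ 2 * ε₀) := by
  refine norm_blockMean_le hL fun x hx => ?_
  have h := norm_loopW_Tavg_sub_one_le_local hL hd U (fun b => (mem_U1.mp (hU b)).1)
    (fun b => (mem_U1.mp (hU b)).2) hε₀ hsm c (fun p i j hij _ _ => h44 p i j hij) hx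
  have hω : omegaA d L ε₀ = 10 * (((d : ℝ) * L) ^ 2 * ε₀) := by rw [omegaA]; ring
  rw [hω] at h
  exact (norm_mlog_le_two_mul (h.trans (by linarith))).trans (by linarith)

end Exponent

/-! ## § 5  The (0.12)/(0.11) average IS the coarse gauge transform `e^{−Ξ}` of the tree average, to second order -/

section Comparison

variable {𝔸 : Type*} [NormedRing 𝔸] [NormedAlgebra ℂ 𝔸] [NormOneClass 𝔸] [CompleteSpace 𝔸] (L : ℕ)

/-- [cite: Balaban1987RG1, (0.12) p.254] the coarse-lattice gauge transformation `w(y) = exp[−Ξ(y)]` built from the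
block means of the Federbush logarithms. -/
def wXi (U : ZdEdge d → 𝔸ˣ) (y : Fin d → ℤ) : 𝔸ˣ := (expU (Xi L U y))⁻¹

/-- [cite: Balaban1987RG1, (0.12) p.254] the comparison configuration `w(c₋) M^tree(c) w(c₊)⁻¹ = (M^tree)^w(c)` on the
coarse lattice (`QuantumLattice.gaugeTransformZd`). -/
def avgTw (U : ZdEdge d → 𝔸ˣ) : ZdEdge d → 𝔸ˣ := gaugeTransformZd (wXi L U) (avgT L U)

variable {L}

omit [NormOneClass 𝔸] in
/-- [cite: Balaban1987RG1, (0.12) p.254] `(M^tree)^w(c) = e^{−Ξ(c₋)} · e^{A_tree(c)} · e^{U(c)Ξ(c₊)U(c)⁻¹} · U(c)`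
(`exp` of a conjugate is the conjugate of `exp`). -/
theorem val_avgTw (U : ZdEdge d → 𝔸ˣ) (c : ZdEdge d) :
    ((avgTw L U c : 𝔸ˣ) : 𝔸) = exp (-Xi L U c.1) * exp (expo L (fun U : ZdEdge d → 𝔸ˣ => gammaT L U) U c)
      * exp (((Ustr L U c : 𝔸ˣ) : 𝔸) * Xi L U (c.1 + Pi.single c.2 1) * (((Ustr L U c)⁻¹ : 𝔸ˣ) : 𝔸))
      * ((Ustr L U c : 𝔸ˣ) : 𝔸) := by
  rw [exp_conj_units]
  simp only [avgTw, gaugeTransformZd, wXi, inv_inv, Units.val_mul, val_inv_expU, val_expU, val_avgT, mul_assoc,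
    Units.inv_mul, mul_one]

/-- [cite: Balaban1987RG1, p.254] **THE (0.12) AVERAGE OVER THE AVERAGED CONTOUR VARIABLES (0.11) IS THE COARSE GAUGE
TRANSFORM `e^{−Ξ}` OF THE (0.12) AVERAGE OVER THE TREE CONTOURS, TO SECOND ORDER** («This average has properties
similar to the properties of the average introduced in (0.4)»): `‖Ū(c) − e^{−Ξ(c₋)} M^tree(c) e^{Ξ(c₊)}‖ ≤
2200·((dL)²ε₀)²` on an `ε₀`-regular `U1`-valued configuration with `(dL)²ε₀ ≤ 1/100`. -/
theorem norm_avgBar_sub_avgTw_le (hL : 0 < L) (hd : 1 ≤ d) (U : ZdEdge d → 𝔸ˣ) (hU : ∀ b, U b ∈ U1 𝔸)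
    {ε₀ : ℝ} (hε₀ : 0 ≤ ε₀) (hsm : ((d : ℝ) * L) ^ 2 * ε₀ ≤ 1 / 100)
    (h44 : ∀ (p : Fin d → ℤ) (i j : Fin d), i ≠ j → ‖((plaquetteHolonomyZd U p i j : 𝔸ˣ) : 𝔸) - 1‖ ≤ ε₀)
    (c : ZdEdge d) :
    ‖((avgBar L U c : 𝔸ˣ) : 𝔸) - ((avgTw L U c : 𝔸ˣ) : 𝔸)‖ ≤ 2200 * (((d : ℝ) * L) ^ 2 * ε₀) ^ 2 := by
  set δ : ℝ := ((d : ℝ) * L) ^ 2 * ε₀ with hδ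
  have hδ0 : 0 ≤ δ := by positivity
  have hS : Ustr L U c ∈ U1 𝔸 := Ustr_mem_U1 U hU c
  have ha : ‖-Xi L U c.1‖ ≤ 6 * δ := by rw [norm_neg]; exact norm_Xi_le hL U hU hε₀ hsm h44 c.1
  have hb := norm_expo_gammaT_le hL hd U hU hε₀ hsm h44 c
  have hc : ‖((Ustr L U c : 𝔸ˣ) : 𝔸) * Xi L U (c.1 + Pi.single c.2 1) * (((Ustr L U c)⁻¹ : 𝔸ˣ) : 𝔸)‖ ≤ 6 * δ :=
    (norm_units_conj_le hS _).trans (norm_Xi_le hL U hU hε₀ hsm h44 _)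
  have he := norm_Erem_le hL hd U hU hε₀ hsm h44 c
  have hmain := norm_exp_add3_sub_le ha hb hc he (by rw [← hδ]; linarith)
    (by rw [← hδ]; nlinarith [mul_le_mul_of_nonneg_left hsm hδ0])
  rw [val_avgBar, val_avgTw, expo_Tavg_eq, ← sub_mul]
  calc _ ≤ ‖exp (-Xi L U c.1 + expo L (fun U : ZdEdge d → 𝔸ˣ => gammaT L U) U c
            + ((Ustr L U c : 𝔸ˣ) : 𝔸) * Xi L U (c.1 + Pi.single c.2 1) * (((Ustr L U c)⁻¹ : 𝔸ˣ) : 𝔸) + Erem L U c)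
          - exp (-Xi L U c.1) * exp (expo L (fun U : ZdEdge d → 𝔸ˣ => gammaT L U) U c)
            * exp (((Ustr L U c : 𝔸ˣ) : 𝔸) * Xi L U (c.1 + Pi.single c.2 1) * (((Ustr L U c)⁻¹ : 𝔸ˣ) : 𝔸))‖
          * ‖((Ustr L U c : 𝔸ˣ) : 𝔸)‖ := norm_mul_le _ _
    _ ≤ ((6 * δ + 2 * δ + 6 * δ + 1024 * δ ^ 2) ^ 2 + 3 * (6 * δ + 2 * δ + 6 * δ) ^ 2 + 1024 * δ ^ 2) * 1 :=
        mul_le_mul hmain hS.1 (norm_nonneg _) (by positivity)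
    _ ≤ 2200 * δ ^ 2 := by
        have hδ1 : δ ≤ 1 / 100 := hsm
        have h1 : 1024 * δ ^ 2 ≤ 11 * δ := by nlinarith
        nlinarith [sq_nonneg δ, mul_nonneg hδ0 (sq_nonneg δ)]

/-- [cite: Balaban1987RG1, (0.12) p.254] norm bounds: `‖Ū(c)‖, ‖Ū(c)⁻¹‖ ≤ e^{20(dL)²ε₀}`. -/
theorem norm_avgBar_le (hL : 0 < L) (hd : 1 ≤ d) (U : ZdEdge d → 𝔸ˣ) (hU : ∀ b, U b ∈ U1 𝔸)
    {ε₀ : ℝ} (hε₀ : 0 ≤ ε₀) (hsm : ((d : ℝ) * L) ^ 2 * ε₀ ≤ 1 / 100)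
    (h44 : ∀ (p : Fin d → ℤ) (i j : Fin d), i ≠ j → ‖((plaquetteHolonomyZd U p i j : 𝔸ˣ) : 𝔸) - 1‖ ≤ ε₀)
    (c : ZdEdge d) :
    ‖((avgBar L U c : 𝔸ˣ) : 𝔸)‖ ≤ Real.exp (20 * (((d : ℝ) * L) ^ 2 * ε₀)) ∧
      ‖(((avgBar L U c)⁻¹ : 𝔸ˣ) : 𝔸)‖ ≤ Real.exp (20 * (((d : ℝ) * L) ^ 2 * ε₀)) := by
  have hS : Ustr L U c ∈ U1 𝔸 := Ustr_mem_U1 U hU c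
  have hA := norm_expo_Tavg_le hL hd U hU hε₀ hsm h44 c
  have hA' : ‖-expo L (fun U : ZdEdge d → 𝔸ˣ => Tavg L U) U c‖ ≤ 20 * (((d : ℝ) * L) ^ 2 * ε₀) := by
    rwa [norm_neg]
  have hpos : 0 ≤ Real.exp (20 * (((d : ℝ) * L) ^ 2 * ε₀)) := (Real.exp_pos _).le
  refine ⟨?_, ?_⟩
  · rw [val_avgBar]
    calc _ ≤ ‖exp (expo L (fun U : ZdEdge d → 𝔸ˣ => Tavg L U) U c)‖ * ‖((Ustr L U c : 𝔸ˣ) : 𝔸)‖ := norm_mul_le _ _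
      _ ≤ Real.exp (20 * (((d : ℝ) * L) ^ 2 * ε₀)) * 1 := mul_le_mul (norm_exp_le_rexp hA) hS.1 (norm_nonneg _) hpos
      _ = _ := mul_one _
  · have hv : (((avgBar L U c)⁻¹ : 𝔸ˣ) : 𝔸)
        = (((Ustr L U c)⁻¹ : 𝔸ˣ) : 𝔸) * exp (-expo L (fun U : ZdEdge d → 𝔸ˣ => Tavg L U) U c) := by
      rw [show avgBar L U c = expU (expo L (fun U : ZdEdge d → 𝔸ˣ => Tavg L U) U c) * Ustr L U c from rfl,
        mul_inv_rev, Units.val_mul, val_inv_expU]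
    rw [hv]
    calc _ ≤ ‖(((Ustr L U c)⁻¹ : 𝔸ˣ) : 𝔸)‖ * ‖exp (-expo L (fun U : ZdEdge d → 𝔸ˣ => Tavg L U) U c)‖ :=
          norm_mul_le _ _
      _ ≤ 1 * Real.exp (20 * (((d : ℝ) * L) ^ 2 * ε₀)) := mul_le_mul hS.2 (norm_exp_le_rexp hA') (norm_nonneg _) zero_le_one
      _ = _ := one_mul _

/-- [cite: Balaban1987RG1, (0.12) p.254] norm bounds for the comparison configuration:
`‖(M^tree)^w(c)‖, ‖(M^tree)^w(c)⁻¹‖ ≤ e^{20(dL)²ε₀}` (`6 + 2 + 6 ≤ 20`). -/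
theorem norm_avgTw_le (hL : 0 < L) (hd : 1 ≤ d) (U : ZdEdge d → 𝔸ˣ) (hU : ∀ b, U b ∈ U1 𝔸)
    {ε₀ : ℝ} (hε₀ : 0 ≤ ε₀) (hsm : ((d : ℝ) * L) ^ 2 * ε₀ ≤ 1 / 100)
    (h44 : ∀ (p : Fin d → ℤ) (i j : Fin d), i ≠ j → ‖((plaquetteHolonomyZd U p i j : 𝔸ˣ) : 𝔸) - 1‖ ≤ ε₀)
    (c : ZdEdge d) :
    ‖((avgTw L U c : 𝔸ˣ) : 𝔸)‖ ≤ Real.exp (20 * (((d : ℝ) * L) ^ 2 * ε₀)) ∧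
      ‖(((avgTw L U c)⁻¹ : 𝔸ˣ) : 𝔸)‖ ≤ Real.exp (20 * (((d : ℝ) * L) ^ 2 * ε₀)) := by
  set δ : ℝ := ((d : ℝ) * L) ^ 2 * ε₀ with hδ
  have hδ0 : 0 ≤ δ := by positivity
  have hS : Ustr L U c ∈ U1 𝔸 := Ustr_mem_U1 U hU c
  have hXi := norm_Xi_le hL U hU hε₀ hsm h44 c.1
  have hXi' := norm_Xi_le hL U hU hε₀ hsm h44 (c.1 + Pi.single c.2 1)
  have hT := norm_expo_gammaT_le hL hd U hU hε₀ hsm h44 c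
  have e1 : ‖exp (Xi L U c.1)‖ ≤ Real.exp (6 * δ) := norm_exp_le_rexp hXi
  have e1' : ‖exp (-Xi L U c.1)‖ ≤ Real.exp (6 * δ) := norm_exp_le_rexp (by rwa [norm_neg])
  have e2 : ‖exp (expo L (fun U : ZdEdge d → 𝔸ˣ => gammaT L U) U c)‖ ≤ Real.exp (2 * δ) := norm_exp_le_rexp hT
  have e2' : ‖exp (-expo L (fun U : ZdEdge d → 𝔸ˣ => gammaT L U) U c)‖ ≤ Real.exp (2 * δ) :=
    norm_exp_le_rexp (by rwa [norm_neg])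
  have e3 : ‖exp (Xi L U (c.1 + Pi.single c.2 1))‖ ≤ Real.exp (6 * δ) := norm_exp_le_rexp hXi'
  have e3' : ‖exp (-Xi L U (c.1 + Pi.single c.2 1))‖ ≤ Real.exp (6 * δ) := norm_exp_le_rexp (by rwa [norm_neg])
  have hexp : Real.exp (6 * δ) * Real.exp (2 * δ) * 1 * Real.exp (6 * δ) ≤ Real.exp (20 * δ) := by
    rw [mul_one, ← Real.exp_add, ← Real.exp_add]
    exact Real.exp_le_exp.mpr (by linarith)
  have n0 := fun (t : ℝ) => (Real.exp_pos t).le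
  refine ⟨?_, ?_⟩
  · have hv : ((avgTw L U c : 𝔸ˣ) : 𝔸) = exp (-Xi L U c.1)
        * exp (expo L (fun U : ZdEdge d → 𝔸ˣ => gammaT L U) U c) * ((Ustr L U c : 𝔸ˣ) : 𝔸)
        * exp (Xi L U (c.1 + Pi.single c.2 1)) := by
      simp only [avgTw, gaugeTransformZd, wXi, inv_inv, Units.val_mul, val_inv_expU, val_expU, val_avgT, mul_assoc]
    rw [hv]
    exact (norm_mul4_le _ _ _ _).trans ((prod4_le (norm_nonneg _) (norm_nonneg _) (norm_nonneg _) (norm_nonneg _)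
      e1' e2 hS.1 e3).trans hexp)
  · have hv : (((avgTw L U c)⁻¹ : 𝔸ˣ) : 𝔸) = exp (-Xi L U (c.1 + Pi.single c.2 1))
        * (((Ustr L U c)⁻¹ : 𝔸ˣ) : 𝔸) * exp (-expo L (fun U : ZdEdge d → 𝔸ˣ => gammaT L U) U c)
        * exp (Xi L U c.1) := by
      simp only [avgTw, gaugeTransformZd, wXi, inv_inv, mul_inv_rev, Units.val_mul, val_inv_expU, val_expU, avgT,
        avgM, expo, mul_assoc]
    rw [hv]
    have hexp' : Real.exp (6 * δ) * 1 * Real.exp (2 * δ) * Real.exp (6 * δ) ≤ Real.exp (20 * δ) := by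
      rw [mul_one, ← Real.exp_add, ← Real.exp_add]
      exact Real.exp_le_exp.mpr (by linarith)
    exact (norm_mul4_le _ _ _ _).trans ((prod4_le (norm_nonneg _) (norm_nonneg _) (norm_nonneg _) (norm_nonneg _)
      e3' hS.2 e2' e1).trans hexp')

/-- [cite: Balaban1987RG1, p.254] **THE COARSE PLAQUETTE VARIABLES OF THE TWO AVERAGES AGREE TO SECOND ORDER**:
`‖Ū(∂p′) − (M^tree)^w(∂p′)‖ ≤ 11000·((dL)²ε₀)²` when moreover `(dL)²ε₀ ≤ 1/512` (four factors of norm `≤ e^{20δ}`,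
`4e^{100δ} ≤ 5`). -/
theorem norm_plaq_avgBar_sub_plaq_avgTw_le (hL : 0 < L) (hd : 1 ≤ d) (U : ZdEdge d → 𝔸ˣ) (hU : ∀ b, U b ∈ U1 𝔸)
    {ε₀ : ℝ} (hε₀ : 0 ≤ ε₀) (hsm : ((d : ℝ) * L) ^ 2 * ε₀ ≤ 1 / 512)
    (h44 : ∀ (p : Fin d → ℤ) (i j : Fin d), i ≠ j → ‖((plaquetteHolonomyZd U p i j : 𝔸ˣ) : 𝔸) - 1‖ ≤ ε₀)
    (y : Fin d → ℤ) (μ ν : Fin d) :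
    ‖((plaquetteHolonomyZd (avgBar L U) y μ ν : 𝔸ˣ) : 𝔸) - ((plaquetteHolonomyZd (avgTw L U) y μ ν : 𝔸ˣ) : 𝔸)‖
      ≤ 11000 * (((d : ℝ) * L) ^ 2 * ε₀) ^ 2 := by
  set δ : ℝ := ((d : ℝ) * L) ^ 2 * ε₀ with hδ
  have hδ0 : 0 ≤ δ := by positivity
  have hsm' : ((d : ℝ) * L) ^ 2 * ε₀ ≤ 1 / 100 := hsm.trans (by norm_num)
  set M : ℝ := Real.exp (20 * δ) with hM
  have hM1 : 1 ≤ M := Real.one_le_exp (by positivity)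
  have hM0 : 0 ≤ M := zero_le_one.trans hM1
  set η : ℝ := 2200 * δ ^ 2 with hη
  have nW := fun b => norm_avgBar_le hL hd U hU hε₀ hsm' h44 b
  have nW' := fun b => norm_avgTw_le hL hd U hU hε₀ hsm' h44 b
  have dW := fun b => norm_avgBar_sub_avgTw_le hL hd U hU hε₀ hsm' h44 b
  have dC := norm_inv_sub_inv_le (nW (y + Pi.single ν 1, μ)).2 (nW' (y + Pi.single ν 1, μ)).2
    (dW (y + Pi.single ν 1, μ))
  have dD := norm_inv_sub_inv_le (nW (y, ν)).2 (nW' (y, ν)).2 (dW (y, ν))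
  have h4 := norm_mul4_sub_mul4_le (M := M) (nW (y + Pi.single μ 1, ν)).1 (nW (y + Pi.single ν 1, μ)).2
    (nW (y, ν)).2 (nW' (y, μ)).1 (nW' (y + Pi.single μ 1, ν)).1 (nW' (y + Pi.single ν 1, μ)).2 (dW (y, μ))
    (dW (y + Pi.single μ 1, ν)) dC dD
  simp only [plaquetteHolonomyZd, Units.val_mul]
  refine h4.trans ?_
  -- numerics: `M³(2η + 2M²η) ≤ 4M⁵η ≤ 5η`
  have hM5 : M ^ 5 ≤ 5 / 4 := by
    have h100 : M ^ 5 = Real.exp (100 * δ) := by rw [hM, ← Real.exp_nat_mul]; ring_nf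
    rw [h100]
    have hx1 : |100 * δ| ≤ 1 := by rw [abs_of_nonneg (by positivity)]; linarith
    have := Real.abs_exp_sub_one_sub_id_le hx1
    have h2 : Real.exp (100 * δ) ≤ 1 + 100 * δ + (100 * δ) ^ 2 := by
      have := (abs_le.mp this).2; linarith
    nlinarith
  have hM3 : M ^ 3 ≤ M ^ 5 := pow_le_pow_right₀ hM1 (by norm_num)
  have hη0 : 0 ≤ η := by positivity
  calc M ^ 3 * (η + η + M * η * M + M * η * M) = 2 * (M ^ 3 * η) + 2 * (M ^ 5 * η) := by ring
    _ ≤ 2 * (M ^ 5 * η) + 2 * (M ^ 5 * η) := by gcongr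
    _ = 4 * M ^ 5 * η := by ring
    _ ≤ 4 * (5 / 4) * η := by gcongr
    _ = 11000 * δ ^ 2 := by rw [hη]; ring

end Comparison

/-! ## § 6  [B7] Proposition 1 (51) for the (0.12) average over the averaged contour variables (0.11) -/

section Prop1

variable {𝔸 : Type*} [NormedRing 𝔸] [NormedAlgebra ℂ 𝔸] [NormOneClass 𝔸] [CompleteSpace 𝔸] {L : ℕ}

/-- [cite: Balaban1987RG1, p.254] **[B7] PROPOSITION 1 (51) HOLDS FOR THE AVERAGE (0.12) OVER THE AVERAGED CONTOUR
VARIABLES (0.11)** («all results of the paper [12] are valid for it. The proofs are in most cases unchanged; in others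
only minor and obvious modifications are needed»): if `U` is `U1`-valued on `ℤᵈ` with `‖U(∂p) − 1‖ ≤ α₀` for every
plaquette and `512(d+1)(d+4)L²α₀ ≤ 1`, then for every plaquette `p′` of the coarse lattice
`‖Ū(∂p′) − 1‖ ≤ L²α₀ + 500·(8(d+1)(d+4)L²α₀)²` — [B7] (51) `|Ū(∂p′) − 1| < L²α₀ + C₀(L²α₀)²` with
`C₀ = 500·64(d+1)²(d+4)²` and `c₂′ = 1/(512(d+1)(d+4)L²)`.  Route («minor and obvious modifications»): Prop. 1 for
the tree-contour average (`prop1_avgT` = `B7Prop1Explicit.prop1_explicit`), the second-order identification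
`Ū = e^{−Ξ}·M^tree·e^{Ξ}` of § 5, and the conjugation covariance of coarse plaquette variables. -/
theorem prop1_avgBar (hL : 0 < L) (U : ZdEdge d → 𝔸ˣ) (hU : ∀ b, U b ∈ U1 𝔸) {α₀ : ℝ} (hα₀ : 0 ≤ α₀)
    (hsmall : 512 * (d + 1) * (d + 4) * (L : ℝ) ^ 2 * α₀ ≤ 1)
    (h44 : ∀ (p : Fin d → ℤ) (i j : Fin d), i ≠ j → ‖((plaquetteHolonomyZd U p i j : 𝔸ˣ) : 𝔸) - 1‖ ≤ α₀)
    (y : Fin d → ℤ) {μ ν : Fin d} (hμν : μ ≠ ν) :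
    ‖((plaquetteHolonomyZd (avgBar L U) y μ ν : 𝔸ˣ) : 𝔸) - 1‖
      ≤ (L : ℝ) ^ 2 * α₀ + 500 * (8 * (d + 1) * (d + 4) * (L : ℝ) ^ 2 * α₀) ^ 2 := by
  have hd : 1 ≤ d := μ.pos
  set δ : ℝ := ((d : ℝ) * L) ^ 2 * α₀ with hδ
  set θ : ℝ := 8 * (d + 1) * (d + 4) * (L : ℝ) ^ 2 * α₀ with hθ
  have hLr : (1 : ℝ) ≤ L := by exact_mod_cast hL
  have hdr : (1 : ℝ) ≤ d := by exact_mod_cast hd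
  have hδ0 : 0 ≤ δ := by positivity
  have hθ0 : 0 ≤ θ := by positivity
  have hθ1 : θ ≤ 1 / 64 := by
    have : 64 * θ = 512 * (d + 1) * (d + 4) * (L : ℝ) ^ 2 * α₀ := by rw [hθ]; ring
    linarith
  have hδθ : 8 * δ ≤ θ := by
    rw [hδ, hθ]
    have h1 : (d : ℝ) ^ 2 ≤ (d + 1) * (d + 4) := by nlinarith
    have h2 : 0 ≤ (L : ℝ) ^ 2 * α₀ := by positivity
    nlinarith
  have hL2δ : (L : ℝ) ^ 2 * α₀ ≤ δ := by
    rw [hδ]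
    have h2 : 0 ≤ (L : ℝ) ^ 2 * α₀ := by positivity
    nlinarith
  have hsm : ((d : ℝ) * L) ^ 2 * α₀ ≤ 1 / 512 := by linarith
  have hsm' : ((d : ℝ) * L) ^ 2 * α₀ ≤ 1 / 100 := hsm.trans (by norm_num)
  -- the two pieces
  have hdiff := norm_plaq_avgBar_sub_plaq_avgTw_le hL hd U hU hα₀ hsm h44 y μ ν
  have htree := prop1_avgT hL U hU hα₀ hsmall h44 y hμν
  -- the comparison plaquette is the conjugate of the tree plaquette
  have hconj : plaquetteHolonomyZd (avgTw L U) y μ ν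
      = wXi L U y * plaquetteHolonomyZd (avgT L U) y μ ν * (wXi L U y)⁻¹ :=
    plaquetteHolonomyZd_gaugeTransformZd _ _ _ _ _
  have hXi := norm_Xi_le hL U hU hα₀ hsm' h44 y
  have hw : ‖((wXi L U y : 𝔸ˣ) : 𝔸)‖ ≤ Real.exp (6 * δ) := by
    rw [wXi, val_inv_expU]; exact norm_exp_le_rexp (by rwa [norm_neg])
  have hw' : ‖(((wXi L U y)⁻¹ : 𝔸ˣ) : 𝔸)‖ ≤ Real.exp (6 * δ) := by
    rw [wXi, inv_inv, val_expU]; exact norm_exp_le_rexp hXi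
  have hconjBound : ‖((plaquetteHolonomyZd (avgTw L U) y μ ν : 𝔸ˣ) : 𝔸) - 1‖
      ≤ Real.exp (6 * δ) * ((L : ℝ) ^ 2 * α₀ + 226 * θ ^ 2) * Real.exp (6 * δ) := by
    rw [hconj, Units.val_mul, Units.val_mul]
    have e1 : ((wXi L U y : 𝔸ˣ) : 𝔸) * ((plaquetteHolonomyZd (avgT L U) y μ ν : 𝔸ˣ) : 𝔸) * (((wXi L U y)⁻¹ : 𝔸ˣ) : 𝔸) - 1
        = ((wXi L U y : 𝔸ˣ) : 𝔸) * (((plaquetteHolonomyZd (avgT L U) y μ ν : 𝔸ˣ) : 𝔸) - 1)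
          * (((wXi L U y)⁻¹ : 𝔸ˣ) : 𝔸) := by
      rw [mul_sub, sub_mul, mul_one, Units.mul_inv]
    rw [e1]
    calc _ ≤ ‖((wXi L U y : 𝔸ˣ) : 𝔸) * (((plaquetteHolonomyZd (avgT L U) y μ ν : 𝔸ˣ) : 𝔸) - 1)‖
            * ‖(((wXi L U y)⁻¹ : 𝔸ˣ) : 𝔸)‖ := norm_mul_le _ _
      _ ≤ (‖((wXi L U y : 𝔸ˣ) : 𝔸)‖ * ‖((plaquetteHolonomyZd (avgT L U) y μ ν : 𝔸ˣ) : 𝔸) - 1‖) * Real.exp (6 * δ) := by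
          gcongr; exact norm_mul_le _ _
      _ ≤ (Real.exp (6 * δ) * ((L : ℝ) ^ 2 * α₀ + 226 * θ ^ 2)) * Real.exp (6 * δ) :=
          mul_le_mul_of_nonneg_right (mul_le_mul hw htree (norm_nonneg _) (Real.exp_pos _).le) (Real.exp_pos _).le
  -- numerics
  have hexp12 : Real.exp (6 * δ) * Real.exp (6 * δ) ≤ 1 + 13 * δ := by
    rw [← Real.exp_add]
    have hx1 : |6 * δ + 6 * δ| ≤ 1 := by rw [abs_of_nonneg (by positivity)]; linarith
    have := (abs_le.mp (Real.abs_exp_sub_one_sub_id_le hx1)).2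
    nlinarith
  calc ‖((plaquetteHolonomyZd (avgBar L U) y μ ν : 𝔸ˣ) : 𝔸) - 1‖
      ≤ ‖((plaquetteHolonomyZd (avgBar L U) y μ ν : 𝔸ˣ) : 𝔸) - ((plaquetteHolonomyZd (avgTw L U) y μ ν : 𝔸ˣ) : 𝔸)‖
          + ‖((plaquetteHolonomyZd (avgTw L U) y μ ν : 𝔸ˣ) : 𝔸) - 1‖ := norm_sub_le_norm_sub_add_norm_sub _ _ _
    _ ≤ 11000 * δ ^ 2 + Real.exp (6 * δ) * ((L : ℝ) ^ 2 * α₀ + 226 * θ ^ 2) * Real.exp (6 * δ) :=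
        add_le_add hdiff hconjBound
    _ = 11000 * δ ^ 2 + (Real.exp (6 * δ) * Real.exp (6 * δ)) * ((L : ℝ) ^ 2 * α₀ + 226 * θ ^ 2) := by ring
    _ ≤ 11000 * δ ^ 2 + (1 + 13 * δ) * ((L : ℝ) ^ 2 * α₀ + 226 * θ ^ 2) :=
        add_le_add le_rfl (mul_le_mul_of_nonneg_right hexp12 (by positivity))
    _ ≤ (L : ℝ) ^ 2 * α₀ + 500 * θ ^ 2 := numerics_final hδ0 hθ1 hδθ hL2δ

end Prop1

/-! ## § 7  The quoted leaf `B7.Prop1Printed`, instantiated for the (0.12)/(0.11) average -/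

section Concrete

variable {𝔸 : Type} [NormedRing 𝔸] [NormedAlgebra ℂ 𝔸] [NormOneClass 𝔸] [CompleteSpace 𝔸]

omit [NormedAlgebra ℂ 𝔸] [CompleteSpace 𝔸] in
/-- [folklore] plaquette variables of a `U1`-valued configuration lie in `U1`. -/
private theorem plaq_mem_U1 {V : ZdEdge d → 𝔸ˣ} (hV : ∀ b, V b ∈ U1 𝔸) (p : Fin d → ℤ) (i j : Fin d) :
    plaquetteHolonomyZd V p i j ∈ U1 𝔸 := by
  unfold plaquetteHolonomyZd
  exact (U1 𝔸).mul_mem ((U1 𝔸).mul_mem ((U1 𝔸).mul_mem (hV _) (hV _)) ((U1 𝔸).inv_mem (hV _)))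
    ((U1 𝔸).inv_mem (hV _))

omit [NormedAlgebra ℂ 𝔸] [CompleteSpace 𝔸] in
/-- [folklore] `‖V(∂p) − 1‖ ≤ 2` for a `U1`-valued configuration. -/
private theorem norm_plaq_sub_one_le_two {V : ZdEdge d → 𝔸ˣ} (hV : ∀ b, V b ∈ U1 𝔸) (p : Fin d → ℤ)
    (i j : Fin d) : ‖((plaquetteHolonomyZd V p i j : 𝔸ˣ) : 𝔸) - 1‖ ≤ 2 := by
  refine (norm_sub_le _ _).trans ?_
  rw [norm_one]
  have := (plaq_mem_U1 hV p i j).1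
  linarith

variable (𝔸) in
/-- [cite: Balaban1987RG1, (0.12) p.254] the concrete one-step family of [B7] Sect. B (`B7.OneStep`) for [I]'s
average (0.12) over the averaged contour variables (0.11) on `ℤᵈ` (corner cubes): index `i = (y, μ, ν)` = a
plaquette `p′` of the coarse lattice (`μ ≠ ν`); `Cfg` = `U1`-valued configurations; `plaqDev U = sup_p ‖U(∂p) − 1‖`
over ALL unit plaquettes (a superset of [B7]'s «p ⊂ Δ(p′)»); `avgDev U = ‖Ū(∂p′) − 1‖` for `Ū = avgBar`; the Prop. 3
fields are unused and trivial (exactly as in `B7Prop1Explicit.concreteOneStep` for the average (42)). -/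
def concreteOneStep012 (L : ℕ) (i : {p : (Fin d → ℤ) × Fin d × Fin d // p.2.1 ≠ p.2.2}) : B7.OneStep where
  Cfg := {U : ZdEdge d → 𝔸ˣ // ∀ b, U b ∈ U1 𝔸}
  Fld := Unit
  plaqDev U := ⨆ p : (Fin d → ℤ) × Fin d × Fin d, ‖((plaquetteHolonomyZd U.1 p.1 p.2.1 p.2.2 : 𝔸ˣ) : 𝔸) - 1‖
  avgDev U := ‖((plaquetteHolonomyZd (avgBar L U.1) i.1.1 i.1.2.1 i.1.2.2 : 𝔸ˣ) : 𝔸) - 1‖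
  fldNorm _ := 0
  IsAnalyticQ _ _ := True
  remC _ _ := 0

/-- [cite: Balaban1987RG1, p.254] **[B7] PROPOSITION 1 AS PRINTED (`B7.Prop1Printed`: «There exist positive constants
C₀, c′₂ such that for every configuration V satisfying (44) for p ⊂ Δ(p′) and for α₀ ≤ c′₂, we have |V̄(∂p′) − 1| <
L²α₀ + C₀(L²α₀)² (51). The constant C₀ depends on d and c′₂ depends on d and L.») PROVED FOR [I]'s AVERAGE (0.12)
OVER THE AVERAGED CONTOUR VARIABLES (0.11)** on `ℤᵈ`, `U1`-valued configurations, `L ≥ 1`, `d ≥ 2`: one may take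
`C₀ = 500·64(d+1)²(d+4)²` (depends on `d` only) and `c₂′ = 1/(512(d+1)(d+4)L²)` (depends on `d` and `L`) — p. 254
«all results of the paper [12] are valid for it», for [12]'s Proposition 1. -/
theorem prop1Printed_avgBar (L : ℕ) (hL : 0 < L) :
    B7.Prop1Printed (L : ℝ) (concreteOneStep012 𝔸 (d := d) L) := by
  refine ⟨500 * (8 * ((d : ℝ) + 1) * (d + 4)) ^ 2, 1 / (512 * ((d : ℝ) + 1) * (d + 4) * (L : ℝ) ^ 2),
    by positivity, by positivity, ?_⟩
  rintro ⟨⟨z, μ, ν⟩, hμν⟩ α₀ hα₀ hc ⟨V, hV⟩ hdev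
  simp only [concreteOneStep012] at hdev ⊢
  have hbdd : BddAbove (Set.range fun p : (Fin d → ℤ) × Fin d × Fin d =>
      ‖((plaquetteHolonomyZd V p.1 p.2.1 p.2.2 : 𝔸ˣ) : 𝔸) - 1‖) :=
    ⟨2, by rintro _ ⟨p, rfl⟩; exact norm_plaq_sub_one_le_two hV _ _ _⟩
  set s := ⨆ p : (Fin d → ℤ) × Fin d × Fin d, ‖((plaquetteHolonomyZd V p.1 p.2.1 p.2.2 : 𝔸ˣ) : 𝔸) - 1‖ with hs
  have hs0 : 0 ≤ s := Real.iSup_nonneg fun _ => norm_nonneg _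
  -- an intermediate `α₁` with `plaqDev V < α₁ < α₀` gives the strict inequality (51)
  set α₁ := (s + α₀) / 2 with hα₁
  have hα₁0 : 0 ≤ α₁ := by positivity
  have hα₁α₀ : α₁ < α₀ := by rw [hα₁]; linarith
  have hα₁α₀' : α₁ ≤ α₀ := hα₁α₀.le
  have h44 : ∀ (x : Fin d → ℤ) (κ κ' : Fin d), κ ≠ κ' →
      ‖((plaquetteHolonomyZd V x κ κ' : 𝔸ˣ) : 𝔸) - 1‖ ≤ α₁ := by
    intro x κ κ' _
    have := le_ciSup hbdd (x, κ, κ')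
    simp only at this
    linarith
  have hLr : (1 : ℝ) ≤ L := by exact_mod_cast hL
  have hsmall : 512 * (d + 1) * (d + 4) * (L : ℝ) ^ 2 * α₁ ≤ 1 := by
    have hpos : 0 < 512 * ((d : ℝ) + 1) * (d + 4) * (L : ℝ) ^ 2 := by positivity
    have h1 := (le_div_iff₀ hpos).mp hc
    have h2 := mul_le_mul_of_nonneg_left hα₁α₀' hpos.le
    linarith
  have hmain := prop1_avgBar hL V hV hα₁0 hsmall h44 z hμν
  refine hmain.trans_lt ?_
  have hL2 : 0 < (L : ℝ) ^ 2 := by positivity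
  have h1 : (L : ℝ) ^ 2 * α₁ < (L : ℝ) ^ 2 * α₀ := by gcongr
  have h2 : (8 * ((d : ℝ) + 1) * (d + 4) * (L : ℝ) ^ 2 * α₁) ^ 2
      ≤ (8 * ((d : ℝ) + 1) * (d + 4) * (L : ℝ) ^ 2 * α₀) ^ 2 := by
    gcongr
  nlinarith

end Concrete

end Literature.MathematicalPhysics.QuantumFieldTheory.Balaban1983to89.B12Average012Prop1

end
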